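import Mathlib.GroupTheory.FreeGroup.CyclicallyReduced
import Mathlib.GroupTheory.Perm.Cycle.Type
import Mathlib.Logic.Equiv.Fin.Rotate
import Mathlib.Data.Fintype.EquivFin
import Mathlib.GroupTheory.Perm.Fin
import Mathlib.Algebra.Ring.Commute
import Literature.GroupTheory.CombinatorialGroupTheory.RandomSclFreeGroup
import HarnessLib

/-!
# Commutator length in free groups: Bardakov's pairing formula (Culler's pairing genus)

Commutator length `cl(g)` (`commutatorLength`, from `RandomSclFreeGroup.lean`: the least `k` with
`g = [x₁, y₁] ⋯ [x_k, y_k]`, `[x, y] = x y x⁻¹ y⁻¹`) of a single cyclically reduced word in a free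
group is computed by a finite maximisation over *pairings*.

For a non-trivial cyclically reduced word `w = x₁ ⋯ xₙ` over an alphabet `A` representing an element
of the commutator subgroup of the free group `F(A)`, a *pairing* of `w` is a fixed-point-free
involution `π` of the index set `{1, …, n}` with `x_{π(i)} = x_i⁻¹` for all `i`; `σ` denotes the
cyclic shift `i ↦ i + 1 (mod n)`. **Bardakov's theorem** ([Heuer2020, Thm 2.4], the case `k = 1`
of Heuer's chain version; originally V. G. Bardakov, *Computing commutator length in free groups*,
Algebra and Logic 39 (2000) [Bardakov2000], there for a two-generator free group — "his proof
immediately generalizes", loc. cit.) computes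

  `cl(w) = |w|/4 − o/2 + 1/2`, where `o = max { orb(σπ) : π a pairing of w }`

and `orb` counts the orbits (cycles, fixed points included) of a permutation. Geometrically
(M. Culler, *Using surfaces to solve equations in free groups*, Topology 20 (1981) [Culler1981];
see [Heuer2020, §2.3]) a pairing glues the `|w|`-gon with boundary word `w` into a closed
orientable surface with `orb(σπ)` vertices, `|w|/2` edges and one face, of genus
`g(π) = |w|/4 − orb(σπ)/2 + 1/2`, and the formula says `cl(w)` is the least genus of a pairing
surface. Consequently ([Heuer2020, Cor. 2.5]) `cl(w) ≤ t` has the NP certificate "a pairing `π`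
with `|w|/2 + 1 ≤ 2t + orb(σπ)`", which is the inline *pairing-genus* predicate of route
`PneNP/BavardGap`.

## Contents
* `commutatorLength_le_of_prod_eq` — small addition to the `commutatorLength` API;
* `orbitCount σ` — number of orbits of a permutation of `Fin n` (cycles of length `≥ 2` plus fixed
  points, written as in the route), `orbitCount_one`;
* `IsPairing w π` — `π` is a pairing of the word `w : List (α × Bool)` (letters as in `FreeGroup`:
  `(a, true) = a`, `(a, false) = a⁻¹`), written as in the route;
* `exists_isPairing_of_mk_mem_commutator` — PROVED: a word in the commutator subgroup admits a
  pairing (letter counting, via `mk_mem_commutator_iff_count`);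
* `BardakovFormula` — the NAMED FACT (Heuer2020 Thm 2.4 with `k = 1`), DISCHARGED below by
  `BardakovFormula_holds` (self-contained combinatorial proof of Culler's pairing-genus theorem,
  namespace `PairingGenus`, see the section `## Proof of Bardakov's formula`);
* `BardakovFormula.commutatorLength_le_iff` — PROVED corollary: under the hypotheses of the fact,
  `cl(w) ≤ t ↔ ∃ pairing π, |w|/2 + 1 ≤ 2t + orb(σπ)`, the right-hand side written literally as
  the inline predicate of route `PneNP/BavardGap` (`(finRotate |w|).trans π`, cycle-type cardinality
  plus fixed points).

## Not here
Heuer's chain version (`k ≥ 2`), the NP-completeness of commutator length [Heuer2020, Thm 1], and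
anything on stable commutator length (see `RandomSclFreeGroup.lean`).

## References
* [Heuer2020] N. Heuer, *Computing commutator length is hard*, arXiv:2001.10230, §2.3.1, Thm 2.4,
  Cor. 2.5.
* [Bardakov2000] V. G. Bardakov, *Computation of commutator length in free groups*, Algebra Log.
  39 (2000) 395–440.
* [Culler1981] M. Culler, *Using surfaces to solve equations in free groups*, Topology 20 (1981)
  133–145.
-/

namespace Literature.GroupTheory.CombinatorialGroupTheory

open scoped Classical

/-- A list of `k` pairs whose commutators multiply to `g` bounds `cl(g) ≤ k`. [folklore] -/
theorem commutatorLength_le_of_prod_eq {G : Type*} [Group G] {g : G} (l : List (G × G))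
    (h : (l.map fun p => p.1 * p.2 * p.1⁻¹ * p.2⁻¹).prod = g) : commutatorLength g ≤ l.length :=
  Nat.sInf_le ⟨l, rfl, h⟩

/-- The number of orbits `orb(σ)` of a permutation `σ` of `Fin n`: the number of cycles of length
`≥ 2` (the cardinality of the cycle type) plus the number of fixed points — written exactly as in
route `PneNP/BavardGap`. [folklore] -/
noncomputable def orbitCount {n : ℕ} (σ : Equiv.Perm (Fin n)) : ℕ :=
  Multiset.card (Equiv.Perm.cycleType σ) + (Finset.univ.filter fun c => σ c = c).card

/-- The identity permutation of `Fin n` has `n` orbits. [folklore] -/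
theorem orbitCount_one (n : ℕ) : orbitCount (1 : Equiv.Perm (Fin n)) = n := by
  simp [orbitCount]

/-- A **pairing** of a word `w = x₁ ⋯ xₙ` over the letters `α × Bool` of `FreeGroup α`
(`(a, true) = a`, `(a, false) = a⁻¹`): a fixed-point-free involution `π` of the index set `Fin n`
matching every letter with an occurrence of its inverse, `x_{π i} = x_i⁻¹` (Bardakov's `Π_w`,
[Heuer2020, §2.3.1]). Written exactly as in route `PneNP/BavardGap`. [cite: Heuer2020, §2.3.1] -/
def IsPairing {α : Type*} (w : List (α × Bool)) (π : Equiv.Perm (Fin w.length)) : Prop :=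
  (∀ i, π (π i) = i) ∧ (∀ i, π i ≠ i) ∧ ∀ i, w.get (π i) = ((w.get i).1, !(w.get i).2)

/-- The number of positions of a word `w` carrying the letter `x` is `w.count x`. [folklore] -/
theorem card_filter_get_eq_count {β : Type*} [DecidableEq β] [BEq β] [LawfulBEq β] (w : List β)
    (x : β) : (Finset.univ.filter fun i : Fin w.length => w.get i = x).card = w.count x := by
  have h := count_ofFn (fun i : Fin w.length => w.get i) x
  rw [List.ofFn_get] at h
  exact h.symm

/-- **A word in the commutator subgroup admits a pairing**: if `FreeGroup.mk w ∈ [F, F]` then every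
letter `a` occurs in `w` as often as `a⁻¹` (`mk_mem_commutator_iff_count`), so the occurrences of
`a` can be matched bijectively with those of `a⁻¹`, letter by letter (`Equiv.ofFiberEquiv`); the
union of this matching and its inverse is a fixed-point-free letter-matching involution.
[folklore] -/
theorem exists_isPairing_of_mk_mem_commutator {α : Type*} [DecidableEq α] (w : List (α × Bool))
    (h : FreeGroup.mk w ∈ commutator (FreeGroup α)) :
    ∃ π : Equiv.Perm (Fin w.length), IsPairing w π := by
  have hcount := (mk_mem_commutator_iff_count w).mp h
  -- fibrewise (letter by letter) the positive and the negative positions are equinumerous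
  have hfib : ∀ (b : Bool) (a : α),
      Fintype.card {i : {i : Fin w.length // (w.get i).2 = b} // (w.get i.1).1 = a} =
        w.count (a, b) := by
    intro b a
    rw [← card_filter_get_eq_count w (a, b), ← Fintype.card_subtype]
    refine Fintype.card_congr ((Equiv.subtypeSubtypeEquivSubtypeInter
      (fun i : Fin w.length => (w.get i).2 = b) (fun i => (w.get i).1 = a)).trans
      (Equiv.subtypeEquivRight fun i => ?_))
    constructor
    · rintro ⟨h2, h1⟩
      exact Prod.ext h1 h2
    · intro hi
      rw [hi]
      exact ⟨rfl, rfl⟩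
  have hcard : ∀ a : α,
      Fintype.card {i : {i : Fin w.length // (w.get i).2 = true} // (w.get i.1).1 = a} =
        Fintype.card {j : {i : Fin w.length // (w.get i).2 = false} // (w.get j.1).1 = a} :=
    fun a => by rw [hfib true a, hfib false a, hcount a]
  -- a letter-preserving bijection `e` from positive to negative positions
  obtain ⟨e, he⟩ : ∃ e : {i : Fin w.length // (w.get i).2 = true} ≃
      {i : Fin w.length // (w.get i).2 = false}, ∀ i, (w.get (e i).1).1 = (w.get i.1).1 :=
    ⟨Equiv.ofFiberEquiv
        (f := fun i : {i : Fin w.length // (w.get i).2 = true} => (w.get i.1).1)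
        (g := fun j : {i : Fin w.length // (w.get i).2 = false} => (w.get j.1).1)
        fun a => Fintype.equivOfCardEq (hcard a),
      fun i => Equiv.ofFiberEquiv_map
        (f := fun i : {i : Fin w.length // (w.get i).2 = true} => (w.get i.1).1)
        (g := fun j : {i : Fin w.length // (w.get i).2 = false} => (w.get j.1).1)
        (fun a => Fintype.equivOfCardEq (hcard a)) i⟩
  have he' : ∀ j, (w.get (e.symm j).1).1 = (w.get j.1).1 := fun j => by
    have := he (e.symm j)
    rw [Equiv.apply_symm_apply] at this
    exact this.symm
  have hneg : ∀ i : Fin w.length, ¬ (w.get i).2 = true → (w.get i).2 = false := fun i hi => by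
    cases hb : (w.get i).2
    · rfl
    · exact absurd hb hi
  -- the involution: `e` on positive positions, `e⁻¹` on negative ones
  let f : Fin w.length → Fin w.length := fun i =>
    if hi : (w.get i).2 = true then (e ⟨i, hi⟩).1 else (e.symm ⟨i, hneg i hi⟩).1
  have hf_pos : ∀ (i) (hi : (w.get i).2 = true), f i = (e ⟨i, hi⟩).1 := fun i hi => by
    dsimp only [f]
    rw [dif_pos hi]
  have hf_neg : ∀ (i) (hi : (w.get i).2 = false), f i = (e.symm ⟨i, hi⟩).1 := fun i hi => by
    have hi' : ¬ (w.get i).2 = true := by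
      rw [hi]
      exact Bool.false_ne_true
    dsimp only [f]
    rw [dif_neg hi']
  have hsign : ∀ i, (w.get (f i)).2 = !(w.get i).2 := by
    intro i
    cases hi : (w.get i).2
    · rw [hf_neg i hi]
      exact (e.symm ⟨i, hi⟩).2
    · rw [hf_pos i hi]
      exact (e ⟨i, hi⟩).2
  have hletter : ∀ i, (w.get (f i)).1 = (w.get i).1 := by
    intro i
    cases hi : (w.get i).2
    · rw [hf_neg i hi]
      exact he' ⟨i, hi⟩
    · rw [hf_pos i hi]
      exact he ⟨i, hi⟩
  have hinv : Function.Involutive f := by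
    intro i
    cases hi : (w.get i).2
    · have h1 : f i = (e.symm ⟨i, hi⟩).1 := hf_neg i hi
      have h2 : (w.get (f i)).2 = true := by
        rw [h1]
        exact (e.symm ⟨i, hi⟩).2
      rw [hf_pos (f i) h2]
      have h3 : (⟨f i, h2⟩ : {i : Fin w.length // (w.get i).2 = true}) = e.symm ⟨i, hi⟩ :=
        Subtype.ext h1
      rw [h3, Equiv.apply_symm_apply]
    · have h1 : f i = (e ⟨i, hi⟩).1 := hf_pos i hi
      have h2 : (w.get (f i)).2 = false := by
        rw [h1]
        exact (e ⟨i, hi⟩).2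
      rw [hf_neg (f i) h2]
      have h3 : (⟨f i, h2⟩ : {i : Fin w.length // (w.get i).2 = false}) = e ⟨i, hi⟩ :=
        Subtype.ext h1
      rw [h3, Equiv.symm_apply_apply]
  refine ⟨hinv.toPerm f, fun i => hinv i, fun i hfix => ?_, fun i => ?_⟩
  · change f i = i at hfix
    have := hsign i
    rw [hfix] at this
    exact absurd this (Bool.self_ne_not _)
  · change w.get (f i) = _
    exact Prod.ext (hletter i) (hsign i)

/-- **Bardakov's formula for commutator length in a free group** ([Heuer2020, Thm 2.4], case
`k = 1` of the chain version; [Bardakov2000]; the pairing-surface / minimal-genus interpretation is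
[Culler1981]), as a named fact: for every alphabet `α` and every non-empty cyclically reduced word
`w` over `α` whose class lies in the commutator subgroup of `FreeGroup α`,

  `cl(w) = |w|/4 − o/2 + 1/2`,  `o = max { orb(σ π) : π ∈ Π_w }`,

where `Π_w` is the (finite, and by `exists_isPairing_of_mk_mem_commutator` non-empty) set of
pairings of `w`, `σ` is the cyclic shift `finRotate |w|` of the index set and `orb` = `orbitCount`
(the orbit counts of `σπ` and of `πσ` agree, the two being conjugate; here
`(finRotate |w|).trans π = π ∘ σ`). The identity is stated in `ℚ`; the maximum is `Finset.sup`
(the printed `max`, the set being non-empty). Non-emptiness of `w` is needed (for `w = 1` the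
right-hand side is `1/2`). [cite: Heuer2020, Thm 2.4 (k = 1)] -/
def BardakovFormula : Prop :=
  ∀ (α : Type) (w : List (α × Bool)), w ≠ [] → FreeGroup.IsCyclicallyReduced w →
    FreeGroup.mk w ∈ commutator (FreeGroup α) →
      (commutatorLength (FreeGroup.mk w) : ℚ) =
        (w.length : ℚ) / 4 -
          (((Finset.univ.filter (IsPairing w)).sup
              fun π => orbitCount ((finRotate w.length).trans π) : ℕ) : ℚ) / 2 + 1 / 2

/-- **Commutator length is pairing genus** (corollary of `BardakovFormula`, proved here; cf.
[Heuer2020, Cor. 2.5]: the pairing is an NP certificate). For a non-empty cyclically reduced word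
`w` in the commutator subgroup of `FreeGroup α` and every `t : ℕ`:

  `cl(w) ≤ t ↔ ∃ π` (fixed-point-free letter-matching involution) `with |w|/2 + 1 ≤ 2t + orb(σπ)`,

the right-hand side being LITERALLY the inline pairing-genus predicate `PgLE w t` of route
`PneNP/BavardGap` (`|w|/2` in `ℕ`; `|w|` is even here). [cite: Heuer2020, Thm 2.4 and Cor. 2.5] -/
theorem BardakovFormula.commutatorLength_le_iff (h : BardakovFormula) {α : Type}
    (w : List (α × Bool)) (hw : w ≠ []) (hred : FreeGroup.IsCyclicallyReduced w)
    (hmem : FreeGroup.mk w ∈ commutator (FreeGroup α)) (t : ℕ) :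
    commutatorLength (FreeGroup.mk w) ≤ t ↔
      ∃ π : Equiv.Perm (Fin (w).length), (∀ i, π (π i) = i) ∧ (∀ i, π i ≠ i) ∧
        (∀ i, (w).get (π i) = (((w).get i).1, !((w).get i).2)) ∧
        (w).length / 2 + 1 ≤ 2 * (t) +
          (Multiset.card (Equiv.Perm.cycleType ((finRotate (w).length).trans π)) +
            (Finset.univ.filter fun c => ((finRotate (w).length).trans π) c = c).card) := by
  have hF := h α w hw hred hmem
  set S : Finset (Equiv.Perm (Fin w.length)) := Finset.univ.filter (IsPairing w) with hS
  set f : Equiv.Perm (Fin w.length) → ℕ := fun π => orbitCount ((finRotate w.length).trans π)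
    with hf
  set o : ℕ := S.sup f with ho
  set c : ℕ := commutatorLength (FreeGroup.mk w) with hc
  -- the formula in integers: 4 c + 2 o = |w| + 2
  have h4q : (4 * c + 2 * o : ℚ) = (w.length : ℚ) + 2 := by rw [hF]; ring
  have h4 : 4 * c + 2 * o = w.length + 2 := by exact_mod_cast h4q
  have hSne : S.Nonempty := by
    obtain ⟨π, hπ⟩ := exists_isPairing_of_mk_mem_commutator w hmem
    exact ⟨π, Finset.mem_filter.mpr ⟨Finset.mem_univ _, hπ⟩⟩
  constructor
  · intro hct
    obtain ⟨π₀, hπ₀S, hπ₀⟩ := Finset.exists_mem_eq_sup S hSne f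
    have hP : IsPairing w π₀ := (Finset.mem_filter.mp hπ₀S).2
    refine ⟨π₀, hP.1, hP.2.1, hP.2.2, ?_⟩
    have hfo : f π₀ = o := hπ₀.symm
    change w.length / 2 + 1 ≤ 2 * t + f π₀
    omega
  · rintro ⟨π, h1, h2, h3, hle⟩
    have hπS : π ∈ S := Finset.mem_filter.mpr ⟨Finset.mem_univ _, h1, h2, h3⟩
    have hfle : f π ≤ o := Finset.le_sup hπS
    change w.length / 2 + 1 ≤ 2 * t + f π at hle
    change c ≤ t
    omega

/-! ## Proof of Bardakov's formula (`BardakovFormula_holds`)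

Everything below is the self-contained combinatorial proof of `BardakovFormula` (Culler's theorem
"commutator length = minimal pairing genus" [Culler1981], in Bardakov's orbit-count form
[Bardakov2000], [Heuer2020, Thm 2.4]). We work with *labelled one-face patterns*
(`PairingGenus.IsPat`): a duplicate-free cyclic list `L` of positions in an ambient finite type,
a pairing `π` (fixed-point-free involution on `L`, identity off `L`) and labels `ℓ` in a group with
`ℓ (π x) = (ℓ x)⁻¹`; `σ = List.formPerm L` is the cyclic successor and the vertices of the glued
surface are the orbits of `σ * π`. The genus inequality "genus `≤ g`" is kept in the subtraction-free
form `2|β| + 2 ≤ 4g + 2·ncl(σπ) + |L|` (`ncl` = number of orbits on the ambient type `β`).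

* Orbit counting (`PairingGenus.ncl`): composing with a transposition changes the number of orbits
  by at most one, and splits a cycle when the two points lie in the same cycle
  (`ncl_le_ncl_swap_mul_add_one`, `ncl_add_one_le_ncl_swap_mul`); `orbitCount = ncl`
  (`orbitCount_eq_ncl`); transport along injections; `List.formPerm` of an erased list
  (`formPerm_erase`).
* Upper bound `cl ≤ genus` (`isProdComm_of_isPat`, `commutatorLength_le_of_isPairing`): induction on
  `|L|` — gauge a non-loop edge to the trivial label and delete it (Case A), or, when there is a
  single vertex, find an interlinked pair `a … b … ā … b̄` and split off a handle by the identity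
  `a x b y a⁻¹ z b⁻¹ w = (zy)·[y⁻¹z⁻¹axby, a⁻¹zy]·(x w z y)·(zy)⁻¹` (`IsPat.prod_handle`).
* Lower bound `genus ≤ cl` (`exists_isPairing_le`): the skeleton pattern of a shortest expression
  `∏ [uᵢ, vᵢ]` has genus `≤ cl(w)`; subdividing labels into letters (`IsPat.exists_subdivide`) and
  following the free reduction of the letter word down to the reduced word `w` (re-pairing
  `IsPat.repair` and deleting cancelling pairs `IsPat.delete`) never increases the genus.
* Integrality of the genus (`orbitCount_parity`) is the sign identity
  `sign(σπ) = sign σ · sign π`.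
-/

namespace PairingGenus

open Equiv Equiv.Perm

section Orbits

variable {β : Type*} [Fintype β] [DecidableEq β]

/-- The orbit (cycle, as a finset, fixed points giving singletons) of `x` under the permutation
`ρ`. [folklore] -/
def cls (ρ : Perm β) (x : β) : Finset β := Finset.univ.filter fun y => ρ.SameCycle x y

/-- The number of orbits (cycles including fixed points) of a permutation of a finite type.
[folklore] -/
def ncl (ρ : Perm β) : ℕ := (Finset.univ.image (cls ρ)).card

/-- Membership in an orbit. [folklore] -/
theorem mem_cls {ρ : Perm β} {x y : β} : y ∈ cls ρ x ↔ ρ.SameCycle x y := by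
  simp [cls]

/-- `x` lies in its own orbit. [folklore] -/
theorem mem_cls_self (ρ : Perm β) (x : β) : x ∈ cls ρ x := mem_cls.2 (SameCycle.refl _ _)

/-- Two orbits coincide iff their base points lie in the same cycle. [folklore] -/
theorem cls_eq_cls_iff {ρ : Perm β} {x y : β} : cls ρ x = cls ρ y ↔ ρ.SameCycle x y := by
  constructor
  · intro h
    have hy : y ∈ cls ρ x := by rw [h]; exact mem_cls_self ρ y
    exact mem_cls.1 hy
  · intro h
    ext z
    simp only [mem_cls]
    exact ⟨fun hz => h.symm.trans hz, fun hz => h.trans hz⟩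

/-- The orbit of a fixed point is a singleton. [folklore] -/
theorem cls_eq_singleton_of_apply_eq {ρ : Perm β} {x : β} (hx : ρ x = x) : cls ρ x = {x} := by
  ext z
  simp only [mem_cls, Finset.mem_singleton]
  constructor
  · intro h
    exact (h.eq_of_left hx).symm
  · rintro rfl
    exact SameCycle.refl _ _

omit [Fintype β] [DecidableEq β] in
/-- If `ρ'` agrees with `ρ` along the forward `ρ`-orbit of `x`, all forward iterates agree.
[folklore] -/
theorem pow_apply_eq_of_forall {ρ ρ' : Perm β} {x : β}
    (h : ∀ n : ℕ, ρ' ((ρ ^ n) x) = ρ ((ρ ^ n) x)) (n : ℕ) : (ρ' ^ n) x = (ρ ^ n) x := by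
  induction n with
  | zero => simp
  | succ n ih => rw [pow_succ', Perm.mul_apply, ih, h n, ← Perm.mul_apply, ← pow_succ']

/-- If `ρ'` agrees with `ρ` along the forward `ρ`-orbit of `x`, the orbits of `x` agree.
[folklore] -/
theorem cls_eq_of_forall {ρ ρ' : Perm β} {x : β}
    (h : ∀ n : ℕ, ρ' ((ρ ^ n) x) = ρ ((ρ ^ n) x)) : cls ρ' x = cls ρ x := by
  ext y
  simp only [mem_cls]
  constructor
  · intro hy
    obtain ⟨n, rfl⟩ := hy.exists_nat_pow_eq
    rw [pow_apply_eq_of_forall h n]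
    exact ⟨n, by simp⟩
  · intro hy
    obtain ⟨n, rfl⟩ := hy.exists_nat_pow_eq
    rw [← pow_apply_eq_of_forall h n]
    exact ⟨n, by simp⟩

/-- Composing with a transposition `swap a b` does not change the orbits avoiding `a` and `b`.
[folklore] -/
theorem cls_swap_mul_of_not_sameCycle {ρ : Perm β} {a b x : β} (ha : ¬ρ.SameCycle x a)
    (hb : ¬ρ.SameCycle x b) : cls (swap a b * ρ) x = cls ρ x := by
  apply cls_eq_of_forall
  intro n
  rw [Perm.mul_apply]
  apply swap_apply_of_ne_of_ne
  · intro h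
    apply ha
    have : ρ.SameCycle x ((ρ ^ (n + 1)) x) := sameCycle_pow_right.2 (SameCycle.refl _ _)
    rwa [pow_succ', Perm.mul_apply, h] at this
  · intro h
    apply hb
    have : ρ.SameCycle x ((ρ ^ (n + 1)) x) := sameCycle_pow_right.2 (SameCycle.refl _ _)
    rwa [pow_succ', Perm.mul_apply, h] at this

/-- The orbits of `ρ` are among: the orbit of `a`, the orbit of `b`, and the orbits avoiding both.
[folklore] -/
theorem image_cls_subset (ρ : Perm β) (a b : β) :
    Finset.univ.image (cls ρ) ⊆ insert (cls ρ a) (insert (cls ρ b)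
      ((Finset.univ.filter fun x => ¬ρ.SameCycle x a ∧ ¬ρ.SameCycle x b).image (cls ρ))) := by
  intro C hC
  obtain ⟨x, -, rfl⟩ := Finset.mem_image.1 hC
  by_cases hxa : ρ.SameCycle x a
  · rw [cls_eq_cls_iff.2 hxa]
    exact Finset.mem_insert_self _ _
  by_cases hxb : ρ.SameCycle x b
  · rw [cls_eq_cls_iff.2 hxb]
    exact Finset.mem_insert_of_mem (Finset.mem_insert_self _ _)
  · refine Finset.mem_insert_of_mem (Finset.mem_insert_of_mem ?_)
    exact Finset.mem_image.2 ⟨x, Finset.mem_filter.2 ⟨Finset.mem_univ _, hxa, hxb⟩, rfl⟩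

/-- Upper bound for the number of orbits in terms of the orbits avoiding `a` and `b`.
[folklore] -/
theorem ncl_le_card_add_two (ρ : Perm β) (a b : β) :
    ncl ρ ≤ ((Finset.univ.filter fun x => ¬ρ.SameCycle x a ∧ ¬ρ.SameCycle x b).image
      (cls ρ)).card + 2 := by
  unfold ncl
  refine (Finset.card_le_card (image_cls_subset ρ a b)).trans ?_
  refine (Finset.card_insert_le _ _).trans ?_
  have := Finset.card_insert_le (cls ρ b)
    ((Finset.univ.filter fun x => ¬ρ.SameCycle x a ∧ ¬ρ.SameCycle x b).image (cls ρ))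
  omega

/-- When `a` and `b` lie in the same cycle, the sharper bound with `+ 1`. [folklore] -/
theorem ncl_le_card_add_one {ρ : Perm β} {a b : β} (hab : ρ.SameCycle a b) :
    ncl ρ ≤ ((Finset.univ.filter fun x => ¬ρ.SameCycle x a ∧ ¬ρ.SameCycle x b).image
      (cls ρ)).card + 1 := by
  unfold ncl
  refine (Finset.card_le_card (image_cls_subset ρ a b)).trans ?_
  rw [cls_eq_cls_iff.2 hab, Finset.insert_idem]
  exact Finset.card_insert_le _ _

/-- **Merging bound**: composing with any transposition loses at most one orbit (the orbits
avoiding `a`, `b` persist, and there is at least the new orbit of `a`). [folklore] -/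
theorem ncl_le_ncl_swap_mul_add_one (ρ : Perm β) (a b : β) :
    ncl ρ ≤ ncl (swap a b * ρ) + 1 := by
  have h1 := ncl_le_card_add_two ρ a b
  set R := (Finset.univ.filter fun x => ¬ρ.SameCycle x a ∧ ¬ρ.SameCycle x b) with hR
  have h2 : (insert (cls (swap a b * ρ) a) (R.image (cls ρ))).card ≤ ncl (swap a b * ρ) := by
    apply Finset.card_le_card
    intro C hC
    rcases Finset.mem_insert.1 hC with rfl | hC
    · exact Finset.mem_image.2 ⟨a, Finset.mem_univ _, rfl⟩
    · obtain ⟨x, hx, rfl⟩ := Finset.mem_image.1 hC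
      obtain ⟨-, hxa, hxb⟩ := Finset.mem_filter.1 hx
      exact Finset.mem_image.2 ⟨x, Finset.mem_univ _, cls_swap_mul_of_not_sameCycle hxa hxb⟩
  have h3 : cls (swap a b * ρ) a ∉ R.image (cls ρ) := by
    intro h
    obtain ⟨x, hx, hxe⟩ := Finset.mem_image.1 h
    obtain ⟨-, hxa, -⟩ := Finset.mem_filter.1 hx
    apply hxa
    have : a ∈ cls ρ x := by rw [hxe]; exact mem_cls_self _ _
    exact mem_cls.1 this
  rw [Finset.card_insert_of_notMem h3] at h2
  omega

/-- Symmetric form of the merging bound: composing with a transposition creates at most one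
orbit. [folklore] -/
theorem ncl_swap_mul_le (ρ : Perm β) (a b : β) : ncl (swap a b * ρ) ≤ ncl ρ + 1 := by
  have := ncl_le_ncl_swap_mul_add_one (swap a b * ρ) a b
  rwa [swap_mul_self_mul] at this

/-- Core of the **splitting bound**: if `a ≠ b` lie in the same cycle of `ρ`, then they lie
in different cycles of `swap a b * ρ`. [folklore] -/
theorem not_sameCycle_swap_mul {ρ : Perm β} {a b : β} (hne : a ≠ b) (hab : ρ.SameCycle a b) :
    ¬(swap a b * ρ).SameCycle a b := by
  classical
  -- minimal positive `k` with `ρ^k a = b`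
  have hex : ∃ k : ℕ, 0 < k ∧ (ρ ^ k) a = b := by
    obtain ⟨k, hk, -, hkab⟩ := hab.exists_pow_eq''
    exact ⟨k, hk, hkab⟩
  let k := Nat.find hex
  have hk : 0 < k ∧ (ρ ^ k) a = b := Nat.find_spec hex
  have hmin : ∀ i, 0 < i → i < k → (ρ ^ i) a ≠ b := fun i hi hik h =>
    Nat.find_min hex hik ⟨hi, h⟩
  -- `A₀ = {ρ^i a | i < k}` is forward invariant under `swap a b * ρ` and misses `b`
  have hstep : ∀ i, i < k → ∃ j, j < k ∧ (swap a b * ρ) ((ρ ^ i) a) = (ρ ^ j) a := by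
    intro i hi
    rw [Perm.mul_apply, ← Perm.mul_apply ρ, ← pow_succ']
    by_cases h : i + 1 = k
    · refine ⟨0, hk.1, ?_⟩
      rw [h, hk.2, swap_apply_right, pow_zero, Perm.one_apply]
    · have hi1 : i + 1 < k := by omega
      refine ⟨i + 1, hi1, swap_apply_of_ne_of_ne ?_ (hmin _ (Nat.succ_pos _) hi1)⟩
      intro hfix
      -- then `ρ^(k-(i+1)) a = b` with smaller positive exponent
      have : (ρ ^ (k - (i + 1))) a = b := by
        have e : k - (i + 1) + (i + 1) = k := by omega
        conv_lhs => rw [← hfix, ← Perm.mul_apply, ← pow_add, e]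
        exact hk.2
      by_cases h0 : k - (i + 1) = 0
      · rw [h0, pow_zero, Perm.one_apply] at this
        exact hne this
      · exact hmin _ (Nat.pos_of_ne_zero h0) (by omega) this
  have hinv : ∀ n : ℕ, ∃ j, j < k ∧ ((swap a b * ρ) ^ n) a = (ρ ^ j) a := by
    intro n
    induction n with
    | zero => exact ⟨0, hk.1, by simp⟩
    | succ n ih =>
      obtain ⟨j, hj, hja⟩ := ih
      obtain ⟨j', hj', hj'a⟩ := hstep j hj
      exact ⟨j', hj', by rw [pow_succ', Perm.mul_apply, hja, hj'a]⟩
  intro hsc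
  obtain ⟨n, hn⟩ := hsc.exists_nat_pow_eq
  obtain ⟨j, hj, hja⟩ := hinv n
  rw [hn] at hja
  by_cases hj0 : j = 0
  · rw [hj0, pow_zero, Perm.one_apply] at hja
    exact hne hja.symm
  · exact hmin j (Nat.pos_of_ne_zero hj0) hj hja.symm

/-- **Splitting bound**: if `a ≠ b` lie in the same cycle of `ρ`, composing with `swap a b`
creates at least one more orbit. [folklore] -/
theorem ncl_add_one_le_ncl_swap_mul {ρ : Perm β} {a b : β} (hne : a ≠ b)
    (hab : ρ.SameCycle a b) : ncl ρ + 1 ≤ ncl (swap a b * ρ) := by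
  have h1 := ncl_le_card_add_one hab
  set R := (Finset.univ.filter fun x => ¬ρ.SameCycle x a ∧ ¬ρ.SameCycle x b) with hR
  have hnot := not_sameCycle_swap_mul hne hab
  have h2 : (insert (cls (swap a b * ρ) a) (insert (cls (swap a b * ρ) b)
      (R.image (cls ρ)))).card ≤ ncl (swap a b * ρ) := by
    apply Finset.card_le_card
    intro C hC
    rcases Finset.mem_insert.1 hC with rfl | hC
    · exact Finset.mem_image.2 ⟨a, Finset.mem_univ _, rfl⟩
    rcases Finset.mem_insert.1 hC with rfl | hC
    · exact Finset.mem_image.2 ⟨b, Finset.mem_univ _, rfl⟩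
    · obtain ⟨x, hx, rfl⟩ := Finset.mem_image.1 hC
      obtain ⟨-, hxa, hxb⟩ := Finset.mem_filter.1 hx
      exact Finset.mem_image.2 ⟨x, Finset.mem_univ _, cls_swap_mul_of_not_sameCycle hxa hxb⟩
  have h3 : cls (swap a b * ρ) b ∉ R.image (cls ρ) := by
    intro h
    obtain ⟨x, hx, hxe⟩ := Finset.mem_image.1 h
    obtain ⟨-, -, hxb⟩ := Finset.mem_filter.1 hx
    apply hxb
    have : b ∈ cls ρ x := by rw [hxe]; exact mem_cls_self _ _
    exact mem_cls.1 this
  have h4 : cls (swap a b * ρ) a ∉ insert (cls (swap a b * ρ) b) (R.image (cls ρ)) := by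
    intro h
    rcases Finset.mem_insert.1 h with h | h
    · exact hnot (cls_eq_cls_iff.1 h)
    · obtain ⟨x, hx, hxe⟩ := Finset.mem_image.1 h
      obtain ⟨-, hxa, -⟩ := Finset.mem_filter.1 hx
      apply hxa
      have : a ∈ cls ρ x := by rw [hxe]; exact mem_cls_self _ _
      exact mem_cls.1 this
  rw [Finset.card_insert_of_notMem h4, Finset.card_insert_of_notMem h3] at h2
  omega

/-- If `ρ` fixes every point outside `S`, its orbits are the orbits inside `S` together with the
singletons outside. [folklore] -/
theorem ncl_eq_card_image_add_card_compl {ρ : Perm β} {S : Finset β}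
    (hS : ∀ x, x ∉ S → ρ x = x) : ncl ρ = (S.image (cls ρ)).card + (Sᶜ).card := by
  unfold ncl
  have hsplit : Finset.univ.image (cls ρ) = S.image (cls ρ) ∪ Sᶜ.image (cls ρ) := by
    rw [← Finset.image_union, Finset.union_compl]
  have hdisj : Disjoint (S.image (cls ρ)) (Sᶜ.image (cls ρ)) := by
    rw [Finset.disjoint_left]
    intro C hC hC'
    obtain ⟨x, hx, rfl⟩ := Finset.mem_image.1 hC
    obtain ⟨y, hy, hxy⟩ := Finset.mem_image.1 hC'
    have hy' := hS y (Finset.mem_compl.1 hy)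
    rw [cls_eq_singleton_of_apply_eq hy'] at hxy
    have : x ∈ ({y} : Finset β) := by rw [hxy]; exact mem_cls_self _ _
    rw [Finset.mem_singleton] at this
    subst this
    exact (Finset.mem_compl.1 hy) hx
  have hinj : Set.InjOn (cls ρ) (Sᶜ : Finset β) := by
    intro x hx y hy hxy
    have hx' := hS x (Finset.mem_compl.1 (Finset.mem_coe.1 hx))
    have hy' := hS y (Finset.mem_compl.1 (Finset.mem_coe.1 hy))
    rw [cls_eq_singleton_of_apply_eq hx', cls_eq_singleton_of_apply_eq hy'] at hxy
    exact Finset.singleton_injective hxy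
  rw [hsplit, Finset.card_union_of_disjoint hdisj, Finset.card_image_of_injOn hinj]

/-- A nonempty set meets at least one orbit. [folklore] -/
theorem one_le_card_image_cls (ρ : Perm β) {S : Finset β} (hS : S.Nonempty) :
    1 ≤ (S.image (cls ρ)).card := by
  obtain ⟨x, hx⟩ := hS
  exact Finset.card_pos.2 ⟨cls ρ x, Finset.mem_image_of_mem _ hx⟩

/-- If all points of `S` lie in one cycle, `S` meets at most one orbit. [folklore] -/
theorem card_image_cls_le_one {ρ : Perm β} {S : Finset β}
    (h : ∀ x ∈ S, ∀ y ∈ S, ρ.SameCycle x y) : (S.image (cls ρ)).card ≤ 1 := by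
  apply Finset.card_le_one.2
  intro C hC D hD
  obtain ⟨x, hx, rfl⟩ := Finset.mem_image.1 hC
  obtain ⟨y, hy, rfl⟩ := Finset.mem_image.1 hD
  exact cls_eq_cls_iff.2 (h x hx y hy)

/-- Two points of `S` in different cycles give two orbits meeting `S`. [folklore] -/
theorem two_le_card_image_cls {ρ : Perm β} {S : Finset β} {x y : β} (hx : x ∈ S) (hy : y ∈ S)
    (h : ¬ρ.SameCycle x y) : 2 ≤ (S.image (cls ρ)).card := by
  have hsub : ({cls ρ x, cls ρ y} : Finset (Finset β)) ⊆ S.image (cls ρ) := by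
    intro C hC
    simp only [Finset.mem_insert, Finset.mem_singleton] at hC
    rcases hC with rfl | rfl
    · exact Finset.mem_image_of_mem _ hx
    · exact Finset.mem_image_of_mem _ hy
  have hne : cls ρ x ≠ cls ρ y := fun e => h (cls_eq_cls_iff.1 e)
  calc 2 = ({cls ρ x, cls ρ y} : Finset (Finset β)).card := (Finset.card_pair hne).symm
    _ ≤ _ := Finset.card_le_card hsub

/-- Orbits of a conjugate permutation. [folklore] -/
theorem cls_conj (ρ g : Perm β) (x : β) : cls (g * ρ * g⁻¹) (g x) = (cls ρ x).image g := by
  ext y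
  simp only [mem_cls, Finset.mem_image]
  constructor
  · intro h
    refine ⟨g⁻¹ y, ?_, by simp⟩
    have := sameCycle_conj.1 h
    simpa using this
  · rintro ⟨z, hz, rfl⟩
    exact hz.conj

/-- The number of orbits is a class function. [folklore] -/
theorem ncl_conj (ρ g : Perm β) : ncl (g * ρ * g⁻¹) = ncl ρ := by
  unfold ncl
  have : Finset.univ.image (cls (g * ρ * g⁻¹)) =
      (Finset.univ.image (cls ρ)).image (Finset.image g) := by
    ext C
    simp only [Finset.mem_image, Finset.mem_univ, true_and]
    constructor
    · rintro ⟨y, rfl⟩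
      refine ⟨cls ρ (g⁻¹ y), ⟨g⁻¹ y, rfl⟩, ?_⟩
      rw [← cls_conj]
      simp
    · rintro ⟨D, ⟨x, rfl⟩, rfl⟩
      exact ⟨g x, cls_conj ρ g x⟩
  rw [this, Finset.card_image_of_injective _ (Finset.image_injective g.injective)]

omit [Fintype β] [DecidableEq β] in
/-- Two functions inducing the same equivalence relation on `s` have images of the same size.
[folklore] -/
theorem card_image_eq_card_image_of_iff {δ ε : Type*} [DecidableEq δ] [DecidableEq ε]
    (s : Finset β) (f : β → δ) (g : β → ε)
    (h : ∀ x ∈ s, ∀ y ∈ s, (f x = f y ↔ g x = g y)) : (s.image f).card = (s.image g).card := by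
  classical
  have e1 : (s.image fun x => (f x, g x)).image Prod.fst = s.image f := by
    rw [Finset.image_image]
    rfl
  have e2 : (s.image fun x => (f x, g x)).image Prod.snd = s.image g := by
    rw [Finset.image_image]
    rfl
  have i1 : Set.InjOn Prod.fst ((s.image fun x => (f x, g x)) : Set (δ × ε)) := by
    intro p hp q hq hpq
    obtain ⟨x, hx, rfl⟩ := Finset.mem_image.1 (Finset.mem_coe.1 hp)
    obtain ⟨y, hy, rfl⟩ := Finset.mem_image.1 (Finset.mem_coe.1 hq)
    dsimp only at hpq
    exact Prod.ext hpq ((h x hx y hy).1 hpq)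
  have i2 : Set.InjOn Prod.snd ((s.image fun x => (f x, g x)) : Set (δ × ε)) := by
    intro p hp q hq hpq
    obtain ⟨x, hx, rfl⟩ := Finset.mem_image.1 (Finset.mem_coe.1 hp)
    obtain ⟨y, hy, rfl⟩ := Finset.mem_image.1 (Finset.mem_coe.1 hq)
    dsimp only at hpq
    exact Prod.ext ((h x hx y hy).2 hpq) hpq
  rw [← e1, ← e2, Finset.card_image_of_injOn i1, Finset.card_image_of_injOn i2]

/-- **Bridge to `orbitCount`**: the number of cycles of length `≥ 2` plus the number of fixed
points is the number of orbits. [folklore] -/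
theorem card_cycleType_add_card_fixed_eq_ncl (ρ : Perm β) :
    Multiset.card ρ.cycleType + (Finset.univ.filter fun x => ρ x = x).card = ncl ρ := by
  have hfix : ∀ x, x ∉ ρ.support → ρ x = x := fun x hx => notMem_support.1 hx
  rw [ncl_eq_card_image_add_card_compl hfix]
  have hcompl : ρ.supportᶜ = Finset.univ.filter fun x => ρ x = x := by
    ext x
    simp [mem_support]
  rw [hcompl]
  congr 1
  rw [cycleType_def, Multiset.card_map, Finset.card_val]
  have himg : ρ.support.image (cycleOf ρ) = ρ.cycleFactorsFinset := by
    ext c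
    simp only [Finset.mem_image, mem_support]
    constructor
    · rintro ⟨x, hx, rfl⟩
      exact cycleOf_mem_cycleFactorsFinset_iff.2 (mem_support.2 hx)
    · intro hc
      obtain ⟨a, ha⟩ := (mem_cycleFactorsFinset_iff.1 hc).1.nonempty_support
      exact ⟨a, mem_support.1 (mem_cycleFactorsFinset_support_le hc ha),
        (cycle_is_cycleOf ha hc).symm⟩
  rw [← himg]
  symm
  apply card_image_eq_card_image_of_iff
  intro x hx y hy
  constructor
  · intro hxy
    exact SameCycle.cycleOf_eq (cls_eq_cls_iff.1 hxy)
  · intro hxy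
    apply cls_eq_cls_iff.2
    have hy' : y ∈ (ρ.cycleOf y).support := mem_support_cycleOf_iff.2 ⟨SameCycle.refl _ _, hy⟩
    rw [← hxy] at hy'
    exact (mem_support_cycleOf_iff.1 hy').1

/-- `orbitCount` is the number of orbits. [folklore] -/
theorem orbitCount_eq_ncl {n : ℕ} (σ : Perm (Fin n)) : orbitCount σ = ncl σ := by
  unfold orbitCount
  convert card_cycleType_add_card_fixed_eq_ncl σ

omit [Fintype β] [DecidableEq β] in
/-- Iterates commute with an intertwining map. [folklore] -/
theorem pow_apply_intertwine {γ : Type*} {ρ : Perm β} {ρ' : Perm γ} {e : γ → β}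
    (he : ∀ i, ρ (e i) = e (ρ' i)) (n : ℕ) (i : γ) : (ρ ^ n) (e i) = e ((ρ' ^ n) i) := by
  induction n with
  | zero => simp
  | succ n ih => rw [pow_succ', Perm.mul_apply, ih, he, ← Perm.mul_apply, ← pow_succ']

/-- **Transport**: if `e : γ → β` is injective, intertwines `ρ'` with `ρ`, and `ρ` fixes the
points outside the range of `e`, then the orbit counts differ by the number of outside points.
[folklore] -/
theorem ncl_add_card_eq_of_intertwine {γ : Type*} [Fintype γ] [DecidableEq γ] {ρ : Perm β}
    {ρ' : Perm γ} {e : γ → β} (hinj : Function.Injective e) (he : ∀ i, ρ (e i) = e (ρ' i))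
    (hfix : ∀ x, (∀ i, e i ≠ x) → ρ x = x) :
    ncl ρ + Fintype.card γ = ncl ρ' + Fintype.card β := by
  set S : Finset β := Finset.univ.image e with hS
  have hS' : ∀ x, x ∉ S → ρ x = x := by
    intro x hx
    apply hfix
    intro i hi
    exact hx (Finset.mem_image.2 ⟨i, Finset.mem_univ _, hi⟩)
  rw [ncl_eq_card_image_add_card_compl hS']
  have hcard : S.card = Fintype.card γ := by
    rw [hS, Finset.card_image_of_injective _ hinj, Finset.card_univ]
  have hcompl : Sᶜ.card + Fintype.card γ = Fintype.card β := by
    rw [Finset.card_compl, ← hcard]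
    have := Finset.card_le_univ S
    omega
  -- orbits of `ρ` inside `S` correspond to orbits of `ρ'`
  have hcls : ∀ i, cls ρ (e i) = (cls ρ' i).image e := by
    intro i
    ext y
    simp only [mem_cls, Finset.mem_image]
    constructor
    · intro h
      obtain ⟨n, rfl⟩ := h.exists_nat_pow_eq
      exact ⟨(ρ' ^ n) i, sameCycle_pow_right.2 (SameCycle.refl _ _), (pow_apply_intertwine he n i).symm⟩
    · rintro ⟨j, hj, rfl⟩
      obtain ⟨n, rfl⟩ := hj.exists_nat_pow_eq
      rw [← pow_apply_intertwine he n i]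
      exact sameCycle_pow_right.2 (SameCycle.refl _ _)
  have himg : S.image (cls ρ) = (Finset.univ.image (cls ρ')).image (Finset.image e) := by
    ext C
    simp only [hS, Finset.mem_image, Finset.mem_univ, true_and]
    constructor
    · rintro ⟨x, ⟨i, rfl⟩, rfl⟩
      exact ⟨cls ρ' i, ⟨i, rfl⟩, (hcls i).symm⟩
    · rintro ⟨D, ⟨i, rfl⟩, rfl⟩
      exact ⟨e i, ⟨i, rfl⟩, hcls i⟩
  rw [himg, Finset.card_image_of_injective _ (Finset.image_injective hinj)]
  unfold ncl
  omega

end Orbits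

/-! ### `List.formPerm` surgery -/

section FormPerm

variable {β : Type*} [DecidableEq β]

omit [DecidableEq β] in
/-- `l₁ ++ x :: l₂` is a rotation of `x :: (l₂ ++ l₁)`. [folklore] -/
theorem isRotated_cons_append (l₁ l₂ : List β) (x : β) :
    (l₁ ++ x :: l₂) ~r (x :: (l₂ ++ l₁)) := by
  have : (l₁ ++ x :: l₂) ~r (x :: l₂ ++ l₁) := List.isRotated_append
  simpa using this

/-- The successor of `x` in the cyclic list `l₁ ++ x :: l₂`. [folklore] -/
theorem formPerm_apply_of_split (l₁ l₂ : List β) (x : β) (h : (l₁ ++ x :: l₂).Nodup) :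
    List.formPerm (l₁ ++ x :: l₂) x = (l₂ ++ l₁).head?.getD x := by
  have hrot := isRotated_cons_append l₁ l₂ x
  rw [List.formPerm_eq_of_isRotated h hrot]
  have h' : (x :: (l₂ ++ l₁)).Nodup := hrot.nodup_iff.1 h
  rcases e : l₂ ++ l₁ with - | ⟨y, ys⟩
  · simp
  · rw [e] at h'
    rw [List.formPerm_apply_head _ _ _ h']
    rfl

/-- **Removing a point from a cyclic list** multiplies its cyclic permutation by the
transposition of that point and its successor. [folklore] -/
theorem formPerm_erase {L : List β} (hL : L.Nodup) {x : β} (hx : x ∈ L) :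
    List.formPerm (L.erase x) = swap x (List.formPerm L x) * List.formPerm L := by
  obtain ⟨l₁, l₂, rfl⟩ := List.append_of_mem hx
  have hx1 : x ∉ l₁ := by
    intro h
    have := List.nodup_append.1 hL
    exact (this.2.2 x h x (List.mem_cons_self)) rfl
  rw [List.erase_append_right _ hx1, List.erase_cons_head]
  have hrot := isRotated_cons_append l₁ l₂ x
  have h' : (x :: (l₂ ++ l₁)).Nodup := hrot.nodup_iff.1 hL
  rw [formPerm_apply_of_split l₁ l₂ x hL, List.formPerm_eq_of_isRotated hL hrot]
  have hrot2 : (l₁ ++ l₂) ~r (l₂ ++ l₁) := List.isRotated_append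
  have h12 : (l₁ ++ l₂).Nodup := by
    have := (List.nodup_cons.1 h').2
    exact hrot2.symm.nodup_iff.1 this
  rw [List.formPerm_eq_of_isRotated h12 hrot2]
  rcases e : l₂ ++ l₁ with - | ⟨y, ys⟩
  · simp only [List.formPerm_nil, List.head?_nil, Option.getD_none, swap_self,
      List.formPerm_singleton, mul_one]
    rfl
  · simp only [List.head?_cons, Option.getD_some, List.formPerm_cons_cons]
    rw [← mul_assoc, swap_mul_self, one_mul]

/-- The cyclic permutation of a duplicate-free list is transitive on the list. [folklore] -/
theorem sameCycle_formPerm {L : List β} (hL : L.Nodup) {x y : β} (hx : x ∈ L) (hy : y ∈ L) :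
    (List.formPerm L).SameCycle x y := by
  obtain ⟨i, hi, rfl⟩ := List.getElem_of_mem hx
  obtain ⟨j, hj, rfl⟩ := List.getElem_of_mem hy
  refine ⟨((L.length - i + j : ℕ) : ℤ), ?_⟩
  rw [zpow_natCast, List.formPerm_pow_apply_getElem _ hL]
  have : (i + (L.length - i + j)) % L.length = j := by
    rw [show i + (L.length - i + j) = L.length + j by omega, Nat.add_mod_left,
      Nat.mod_eq_of_lt hj]
  simp only [this]

/-- `formPerm` of `List.finRange n` is the rotation `finRotate n`. [folklore] -/
theorem formPerm_finRange (n : ℕ) : List.formPerm (List.finRange n) = finRotate n := by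
  ext i
  have hi : i.val < (List.finRange n).length := by simp
  have h1 : (List.finRange n)[i.val]'hi = i := by simp
  conv_lhs => rw [← h1]
  rw [List.formPerm_apply_getElem _ (List.nodup_finRange n)]
  simp only [List.getElem_finRange, List.length_finRange, finRotate_apply]
  rw [Fin.val_add]
  have : NeZero n := ⟨by intro h; subst h; exact i.elim0⟩
  simp

end FormPerm

/-! ### Products of commutators -/

section ProdComm

variable {G : Type*} [Group G]

/-- `u` is a product of exactly `g` commutators. [folklore] -/
def IsProdComm (g : ℕ) (u : G) : Prop :=
  ∃ l : List (G × G), l.length = g ∧ (l.map fun p => p.1 * p.2 * p.1⁻¹ * p.2⁻¹).prod = u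

/-- `1` is a product of `0` commutators. [folklore] -/
theorem isProdComm_zero_one : IsProdComm 0 (1 : G) := ⟨[], rfl, by simp⟩

/-- Prepending a commutator. [folklore] -/
theorem IsProdComm.comm_mul {g : ℕ} {u : G} (h : IsProdComm g u) (c d : G) :
    IsProdComm (g + 1) (c * d * c⁻¹ * d⁻¹ * u) := by
  obtain ⟨l, hl, rfl⟩ := h
  exact ⟨(c, d) :: l, by simp [hl], by simp [mul_assoc]⟩

/-- Monotonicity in the number of commutators (pad with trivial commutators). [folklore] -/
theorem IsProdComm.mono {g g' : ℕ} {u : G} (h : IsProdComm g u) (hg : g ≤ g') :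
    IsProdComm g' u := by
  obtain ⟨d, rfl⟩ := Nat.exists_eq_add_of_le hg
  induction d with
  | zero => simpa using h
  | succ d ih =>
    have := (ih (Nat.le_add_right _ _)).comm_mul 1 1
    simpa [Nat.add_assoc] using this

/-- A conjugate of a product of `g` commutators is a product of `g` commutators. [folklore] -/
theorem IsProdComm.conj {g : ℕ} {u : G} (h : IsProdComm g u) (t : G) :
    IsProdComm g (t * u * t⁻¹) := by
  obtain ⟨l, hl, rfl⟩ := h
  refine ⟨l.map fun p => (t * p.1 * t⁻¹, t * p.2 * t⁻¹), by simp [hl], ?_⟩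
  clear hl
  induction l with
  | nil => simp
  | cons p l ih =>
    simp only [List.map_cons, List.prod_cons] at ih ⊢
    rw [ih]
    group

/-- A product of `g` commutators has commutator length `≤ g`. [folklore] -/
theorem IsProdComm.commutatorLength_le {g : ℕ} {u : G} (h : IsProdComm g u) :
    commutatorLength u ≤ g := by
  obtain ⟨l, hl, hu⟩ := h
  rw [← hl]
  exact commutatorLength_le_of_prod_eq l hu

end ProdComm

/-! ### Labelled one-face patterns -/

section Patterns

variable {β : Type*} {G : Type*} [Group G]

/-- A **labelled pattern**: a duplicate-free cyclic list `L` of positions, a fixed-point-free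
(on `L`) involution `π` of the positions which is the identity off `L` (the pairing), and
labels `ℓ` in a group with `ℓ (π x) = (ℓ x)⁻¹`. [folklore] -/
def IsPat (L : List β) (π : Perm β) (ℓ : β → G) : Prop :=
  L.Nodup ∧ (∀ x, π (π x) = x) ∧ (∀ x, x ∉ L → π x = x) ∧ (∀ x ∈ L, π x ≠ x) ∧
    ∀ x ∈ L, ℓ (π x) = (ℓ x)⁻¹

namespace IsPat

variable {L : List β} {π : Perm β} {ℓ : β → G}

/-- The list of a pattern has no duplicates. [folklore] -/
theorem nodup (h : IsPat L π ℓ) : L.Nodup := h.1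

/-- The pairing is an involution. [folklore] -/
theorem invol (h : IsPat L π ℓ) (x : β) : π (π x) = x := h.2.1 x

/-- The pairing is the identity off the list. [folklore] -/
theorem apply_of_not_mem (h : IsPat L π ℓ) {x : β} (hx : x ∉ L) : π x = x := h.2.2.1 x hx

/-- The pairing has no fixed point on the list. [folklore] -/
theorem apply_ne (h : IsPat L π ℓ) {x : β} (hx : x ∈ L) : π x ≠ x := h.2.2.2.1 x hx

/-- Labels of paired positions are inverse. [folklore] -/
theorem label (h : IsPat L π ℓ) {x : β} (hx : x ∈ L) : ℓ (π x) = (ℓ x)⁻¹ := h.2.2.2.2 x hx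

/-- The pairing preserves the list. [folklore] -/
theorem apply_mem (h : IsPat L π ℓ) {x : β} (hx : x ∈ L) : π x ∈ L := by
  by_contra hn
  have h1 := h.apply_of_not_mem hn
  rw [h.invol] at h1
  exact h.apply_ne hx h1.symm

/-- `π * π = 1`. [folklore] -/
theorem mul_self (h : IsPat L π ℓ) : π * π = 1 := by
  ext x
  simp [h.invol]

/-- `π⁻¹ = π`. [folklore] -/
theorem inv_eq (h : IsPat L π ℓ) : π⁻¹ = π := by
  rw [inv_eq_iff_mul_eq_one, h.mul_self]

/-- A pattern with a single position is impossible; two distinct members force length `≥ 2`.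
[folklore] -/
theorem two_le_length (h : IsPat L π ℓ) {x : β} (hx : x ∈ L) : 2 ≤ L.length := by
  have hπx := h.apply_mem hx
  have hne := h.apply_ne hx
  by_contra hlt
  have hl : L.length ≤ 1 := by omega
  rcases L with - | ⟨a, l⟩
  · simp at hx
  · simp only [List.length_cons, add_le_iff_nonpos_left, nonpos_iff_eq_zero,
      List.length_eq_zero_iff] at hl
    subst hl
    simp only [List.mem_singleton] at hx hπx
    exact hne (hπx.trans hx.symm)

variable [DecidableEq β]

/-- The composite `formPerm L * π` fixes every point off the list. [folklore] -/
theorem rho_apply_of_not_mem (h : IsPat L π ℓ) {x : β} (hx : x ∉ L) :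
    (List.formPerm L * π) x = x := by
  rw [Perm.mul_apply, h.apply_of_not_mem hx, List.formPerm_apply_of_notMem hx]

section Fin

variable [Fintype β]

/-- Orbit count of a pattern = orbits meeting the list + points off the list. [folklore] -/
theorem ncl_eq (h : IsPat L π ℓ) :
    ncl (List.formPerm L * π) =
      (L.toFinset.image (cls (List.formPerm L * π))).card + (Fintype.card β - L.length) := by
  rw [ncl_eq_card_image_add_card_compl (S := L.toFinset)]
  · rw [Finset.card_compl, List.toFinset_card_of_nodup h.nodup]
  · intro x hx
    exact h.rho_apply_of_not_mem (fun hx' => hx (List.mem_toFinset.2 hx'))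

/-- A nonempty pattern has at least `|β| - |L| + 1` orbits. [folklore] -/
theorem card_sub_length_lt_ncl (h : IsPat L π ℓ) (hne : L ≠ []) :
    Fintype.card β - L.length + 1 ≤ ncl (List.formPerm L * π) := by
  rw [h.ncl_eq]
  have : L.toFinset.Nonempty := by
    obtain ⟨x, hx⟩ := List.exists_mem_of_ne_nil L hne
    exact ⟨x, List.mem_toFinset.2 hx⟩
  have := one_le_card_image_cls (List.formPerm L * π) this
  omega

/-- The list of a pattern is no longer than the ambient type. [folklore] -/
theorem length_le_card (h : IsPat L π ℓ) : L.length ≤ Fintype.card β := by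
  rw [← List.toFinset_card_of_nodup h.nodup]
  exact Finset.card_le_univ _

end Fin

/-! #### Deleting a pair of positions -/

/-- `π` commutes with the transposition of a pair. [folklore] -/
theorem mul_swap_pair (h : IsPat L π ℓ) (e : β) : π * swap e (π e) = swap e (π e) * π := by
  rw [mul_swap_eq_swap_mul, h.invol, swap_comm]

/-- **Deletion move**: removing a pair `{e, π e}` of positions (and un-pairing them) gives a
pattern. [folklore] -/
theorem delete (h : IsPat L π ℓ) {e : β} (he : e ∈ L) :
    IsPat ((L.erase e).erase (π e)) (swap e (π e) * π) ℓ := by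
  have hēL := h.apply_mem he
  have hne := h.apply_ne he
  have hmem : ∀ x, x ∈ (L.erase e).erase (π e) ↔ x ∈ L ∧ x ≠ e ∧ x ≠ π e := by
    intro x
    rw [List.Nodup.mem_erase_iff (h.nodup.erase e), List.Nodup.mem_erase_iff h.nodup]
    tauto
  refine ⟨(h.nodup.erase e).erase (π e), ?_, ?_, ?_, ?_⟩
  · intro x
    have hc := h.mul_swap_pair e
    calc (swap e (π e) * π) ((swap e (π e) * π) x)
        = (swap e (π e) * (π * swap e (π e)) * π) x := by simp [Perm.mul_apply]
      _ = x := by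
          rw [hc]
          simp [Perm.mul_apply, h.invol]
  · intro x hx
    rw [hmem] at hx
    rw [Perm.mul_apply]
    by_cases hxL : x ∈ L
    · have : x = e ∨ x = π e := by tauto
      rcases this with rfl | rfl
      · exact swap_apply_right _ _
      · rw [h.invol, swap_apply_left]
    · rw [h.apply_of_not_mem hxL]
      apply swap_apply_of_ne_of_ne
      · rintro rfl
        exact hxL he
      · rintro rfl
        exact hxL hēL
  · intro x hx
    rw [hmem] at hx
    obtain ⟨hxL, hxe, hxē⟩ := hx
    rw [Perm.mul_apply, swap_apply_of_ne_of_ne]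
    · exact h.apply_ne hxL
    · intro h1
      apply hxē
      rw [← h1, h.invol]
    · intro h1
      apply hxe
      rw [← h.invol x, h1, h.invol]
  · intro x hx
    rw [hmem] at hx
    obtain ⟨hxL, hxe, hxē⟩ := hx
    rw [Perm.mul_apply, swap_apply_of_ne_of_ne]
    · exact h.label hxL
    · intro h1
      apply hxē
      rw [← h1, h.invol]
    · intro h1
      apply hxe
      rw [← h.invol x, h1, h.invol]

/-- Membership in the list after a deletion move. [folklore] -/
theorem mem_delete_iff (h : IsPat L π ℓ) {e x : β} :
    x ∈ (L.erase e).erase (π e) ↔ x ∈ L ∧ x ≠ e ∧ x ≠ π e := by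
  rw [List.Nodup.mem_erase_iff (h.nodup.erase e), List.Nodup.mem_erase_iff h.nodup]
  tauto

/-- Length of the list after a deletion move. [folklore] -/
theorem length_delete (h : IsPat L π ℓ) {e : β} (he : e ∈ L) :
    ((L.erase e).erase (π e)).length + 2 = L.length := by
  have hē : π e ∈ L.erase e := (List.mem_erase_of_ne (h.apply_ne he)).2 (h.apply_mem he)
  rw [List.length_erase_of_mem hē, List.length_erase_of_mem he]
  have := h.two_le_length he
  omega

section Fin

variable [Fintype β]

/-- **Deletion does not lose genus**: after deleting a pair from a pattern with at least three
positions, the (ambient) orbit count goes up by at least one. [folklore] -/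
theorem ncl_add_one_le_ncl_delete (h : IsPat L π ℓ) {e : β} (he : e ∈ L) (h3 : 3 ≤ L.length) :
    ncl (List.formPerm L * π) + 1 ≤
      ncl (List.formPerm ((L.erase e).erase (π e)) * (swap e (π e) * π)) := by
  have hēL := h.apply_mem he
  have hne := h.apply_ne he
  set ē := π e with hē
  set σ := List.formPerm L with hσ
  have hL1 : (L.erase e).Nodup := h.nodup.erase e
  have hē1 : ē ∈ L.erase e := (List.mem_erase_of_ne hne).2 hēL
  have hσ1 : List.formPerm (L.erase e) = swap e (σ e) * σ := formPerm_erase h.nodup he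
  have hσ2 : List.formPerm ((L.erase e).erase ē) =
      swap ē (List.formPerm (L.erase e) ē) * List.formPerm (L.erase e) := formPerm_erase hL1 hē1
  set ρ := σ * π with hρ
  set ρ₁ := swap (σ e) (σ ē) * ρ with hρ₁
  have hρ₁e : ρ₁ e = σ e := by
    simp only [hρ₁, hρ, Perm.mul_apply]
    rw [← hē, swap_apply_right]
  set ρ₂ := swap e (ρ₁ e) * ρ₁ with hρ₂
  have hπē : π ē = e := by rw [hē, h.invol]
  have hρ₂ē : ρ₂ ē = List.formPerm (L.erase e) ē := by
    rw [hσ1]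
    simp only [hρ₂, hρ₁, hρ, Perm.mul_apply, hπē]
    rw [← hē, swap_apply_right, swap_apply_left]
  have key : List.formPerm ((L.erase e).erase ē) * (swap e ē * π) = swap ē (ρ₂ ē) * ρ₂ := by
    rw [hσ2, hρ₂ē, hσ1, hρ₂, hρ₁e, hρ₁, hρ]
    have : σ * swap e ē = swap (σ e) (σ ē) * σ := mul_swap_eq_swap_mul σ e ē
    simp only [mul_assoc]
    rw [← mul_assoc σ, this, mul_assoc]
  rw [key]
  -- three steps: ≥ -1, then two splittings
  have s1 : ncl ρ ≤ ncl ρ₁ + 1 := ncl_le_ncl_swap_mul_add_one ρ (σ e) (σ ē)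
  have h2 : 2 ≤ L.length := by omega
  have s2 : ncl ρ₁ + 1 ≤ ncl ρ₂ := by
    apply ncl_add_one_le_ncl_swap_mul
    · rw [hρ₁e]
      exact ((List.formPerm_apply_mem_ne_self_iff _ h.nodup e he).2 h2).symm
    · exact (sameCycle_apply_right).2 (SameCycle.refl _ _)
  have s3 : ncl ρ₂ + 1 ≤ ncl (swap ē (ρ₂ ē) * ρ₂) := by
    apply ncl_add_one_le_ncl_swap_mul
    · rw [hρ₂ē]
      have hlen : 2 ≤ (L.erase e).length := by
        rw [List.length_erase_of_mem he]
        omega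
      exact ((List.formPerm_apply_mem_ne_self_iff _ hL1 ē hē1).2 hlen).symm
    · exact (sameCycle_apply_right).2 (SameCycle.refl _ _)
  omega

end Fin

end IsPat

/-! #### Products over lists -/

section Prods

variable [DecidableEq β]

/-- Erasing an element with trivial label does not change the product of labels. [folklore] -/
theorem prod_map_erase_of_eq_one {L : List β} (hL : L.Nodup) {ℓ : β → G} {e : β}
    (he : ℓ e = 1) : ((L.erase e).map ℓ).prod = (L.map ℓ).prod := by
  by_cases heL : e ∈ L
  · obtain ⟨l₁, l₂, rfl⟩ := List.append_of_mem heL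
    have hx1 : e ∉ l₁ := by
      intro h'
      have := List.nodup_append.1 hL
      exact (this.2.2 e h' e List.mem_cons_self) rfl
    rw [List.erase_append_right _ hx1, List.erase_cons_head]
    simp [he]
  · rw [List.erase_of_not_mem heL]

omit [DecidableEq β] in
/-- Product of labels over a list split at one point. [folklore] -/
theorem prod_map_split (l₁ l₂ : List β) (x : β) (F : β → G) :
    ((l₁ ++ x :: l₂).map F).prod = (l₁.map F).prod * F x * (l₂.map F).prod := by
  simp [mul_assoc]

omit [DecidableEq β] in
/-- A cyclic rotation conjugates the product of labels. [folklore] -/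
theorem prod_map_rotate (l₁ l₂ : List β) (F : β → G) :
    ((l₂ ++ l₁).map F).prod = ((l₁.map F).prod)⁻¹ * ((l₁ ++ l₂).map F).prod * (l₁.map F).prod := by
  simp

omit [DecidableEq β] in
/-- **Gauge telescoping**: multiplying each label `ℓ y` by `h y` on the left and by
`(h (next y))⁻¹` on the right conjugates the total product by `h` of the head. [folklore] -/
theorem prod_map_gauge_aux (h ℓ : β → G) (nx : β → β) (t : β) :
    ∀ (x : β) (xs : List β), (∀ i (hi : i + 1 < (x :: xs).length),
      nx ((x :: xs)[i]) = (x :: xs)[i + 1]) → nx ((x :: xs).getLast (List.cons_ne_nil x xs)) = t →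
      ((x :: xs).map fun y => h y * ℓ y * (h (nx y))⁻¹).prod =
        h x * ((x :: xs).map ℓ).prod * (h t)⁻¹ := by
  intro x xs
  induction xs generalizing x with
  | nil =>
    intro _ hlast
    simp only [List.getLast_singleton] at hlast
    simp [hlast]
  | cons y ys ih =>
    intro hnx hlast
    have h0 : nx x = y := by
      have := hnx 0 (by simp)
      simpa using this
    have h1 : ∀ i (hi : i + 1 < (y :: ys).length), nx ((y :: ys)[i]) = (y :: ys)[i + 1] := by
      intro i hi
      have := hnx (i + 1) (by simpa using hi)
      simpa using this
    have h2 : nx ((y :: ys).getLast (List.cons_ne_nil y ys)) = t := by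
      rw [← hlast]
      simp
    rw [List.map_cons, List.prod_cons, ih y h1 h2, h0]
    simp [mul_assoc]

/-- **Gauge telescoping** for the cyclic successor `formPerm`. [folklore] -/
theorem prod_map_gauge (h ℓ : β → G) (x : β) (xs : List β) (hL : (x :: xs).Nodup) :
    ((x :: xs).map fun y => h y * ℓ y * (h (List.formPerm (x :: xs) y))⁻¹).prod =
      h x * ((x :: xs).map ℓ).prod * (h x)⁻¹ := by
  apply prod_map_gauge_aux
  · intro i hi
    exact List.formPerm_apply_lt_getElem _ hL i hi
  · exact List.formPerm_apply_getLast x xs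

end Prods

namespace IsPat

variable [DecidableEq β] {L : List β} {π : Perm β} {ℓ : β → G}

/-- **Gauge move**: a vertex potential `h` (a function constant on the orbits of
`formPerm L * π`) changes the labels to `h y * ℓ y * (h (σ y))⁻¹`, giving again a pattern.
[folklore] -/
theorem gauge (hP : IsPat L π ℓ) (h : β → G) (hh : ∀ y, h ((List.formPerm L * π) y) = h y) :
    IsPat L π (fun y => h y * ℓ y * (h (List.formPerm L y))⁻¹) := by
  refine ⟨hP.nodup, hP.invol, hP.2.2.1, hP.2.2.2.1, ?_⟩
  intro y hy
  have h1 : h (π y) = h (List.formPerm L y) := by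
    have := hh (π y)
    rw [Perm.mul_apply, hP.invol] at this
    exact this.symm
  have h2 : h (List.formPerm L (π y)) = h y := hh y
  dsimp only
  rw [h1, h2, hP.label hy]
  group

end IsPat

end Patterns

/-! ### The upper bound: the word of a pattern of genus `≤ g` is a product of `g` commutators -/

section Upper

variable {β : Type*} [Fintype β] [DecidableEq β] {G : Type*} [Group G]

omit [Fintype β] in
/-- If every position of a duplicate-free cyclic list lies in the same cycle (of a permutation
`ρ`) as its successor, then all positions lie in one cycle of `ρ`. [folklore] -/
theorem sameCycle_of_forall_sameCycle_next {L : List β} (hL : L.Nodup) {ρ : Perm β}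
    (h : ∀ e ∈ L, ρ.SameCycle e (List.formPerm L e)) :
    ∀ x ∈ L, ∀ y ∈ L, ρ.SameCycle x y := by
  have key : ∀ i (hi : i < L.length), ρ.SameCycle (L[0]'(by omega)) (L[i]) := by
    intro i
    induction i with
    | zero => intro hi; exact SameCycle.refl _ _
    | succ i ih =>
      intro hi
      have h1 := ih (by omega)
      have h2 := h (L[i]) (List.getElem_mem _)
      rw [List.formPerm_apply_lt_getElem _ hL i hi] at h2
      exact h1.trans h2
  intro x hx y hy
  obtain ⟨i, hi, rfl⟩ := List.getElem_of_mem hx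
  obtain ⟨j, hj, rfl⟩ := List.getElem_of_mem hy
  exact (key i hi).symm.trans (key j hj)

/-- **Case A supply**: if the positions meet at least two orbits of `formPerm L * π`, some
position is not in the orbit of its successor (a "non-loop edge"). [folklore] -/
theorem exists_not_sameCycle_next {L : List β} (hL : L.Nodup) {π : Perm β}
    (h2 : 2 ≤ (L.toFinset.image (cls (List.formPerm L * π))).card) :
    ∃ e ∈ L, ¬(List.formPerm L * π).SameCycle e (List.formPerm L e) := by
  by_contra hne
  simp only [not_exists, not_and, not_not] at hne
  have hall := sameCycle_of_forall_sameCycle_next hL hne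
  have := card_image_cls_le_one (ρ := List.formPerm L * π) (S := L.toFinset)
    (fun x hx y hy => hall x (List.mem_toFinset.1 hx) y (List.mem_toFinset.1 hy))
  omega

omit [Fintype β] [DecidableEq β] in
/-- `(M ++ [e]).head?.getD c = M.head?.getD e`. [folklore] -/
theorem head?_append_singleton_getD (M : List β) (e c : β) :
    (M ++ [e]).head?.getD c = M.head?.getD e := by
  cases M <;> rfl

omit [Fintype β] [DecidableEq β] in
/-- Length bookkeeping for the handle pattern. [folklore] -/
theorem length_handle {L : List β} {a a' b b' : β} {X Y Z W : List β}
    (hLeq : L = a :: (X ++ b :: (Y ++ a' :: (Z ++ b' :: W)))) :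
    (X ++ W ++ Z ++ Y).length + 4 = L.length := by
  rw [hLeq]
  simp only [List.length_cons, List.length_append]
  omega

namespace IsPat

variable {L : List β} {π : Perm β} {ℓ : β → G}

/-- **Interlinked pairs exist** in a one-vertex pattern: if all positions of
`L = a X' ā W'` lie in one orbit of `formPerm L * π`, some position of `X'` is paired into `W'`.
[folklore] -/
theorem exists_interlinked (hP : IsPat L π ℓ) {a : β} {X' W' : List β}
    (hLeq : L = a :: (X' ++ π a :: W'))
    (hall : ∀ x ∈ L, ∀ y ∈ L, (List.formPerm L * π).SameCycle x y) :
    ∃ b ∈ X', π b ∈ W' := by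
  by_contra hno
  simp only [not_exists, not_and] at hno
  have haL : a ∈ L := by rw [hLeq]; exact List.mem_cons_self
  have hN : (a :: (X' ++ π a :: W')).Nodup := hLeq ▸ hP.nodup
  have haX : a ∉ X' := by
    intro h
    exact (List.nodup_cons.1 hN).1 (List.mem_append_left _ h)
  have hāX : π a ∉ X' := by
    intro h
    have := (List.nodup_cons.1 hN).2
    rw [List.nodup_append] at this
    exact this.2.2 _ h _ List.mem_cons_self rfl
  -- closure of `X'` under `π`
  have hcl : ∀ b ∈ X', π b ∈ X' := by
    intro b hb
    have hbL : b ∈ L := by rw [hLeq]; exact List.mem_cons_of_mem _ (List.mem_append_left _ hb)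
    have hπbL := hP.apply_mem hbL
    rw [hLeq] at hπbL
    simp only [List.mem_cons, List.mem_append] at hπbL
    rcases hπbL with h1 | h1 | h1 | h1
    · exfalso
      apply hāX
      rw [← h1, hP.invol]
      exact hb
    · exact h1
    · exfalso
      exact haX ((π.injective h1) ▸ hb)
    · exact absurd h1 (hno b hb)
  -- the invariant set
  set S : Finset β := insert (π a) X'.toFinset with hS
  have hSstep : ∀ s ∈ S, (List.formPerm L * π) s ∈ S := by
    intro s hs
    rw [hS, Finset.mem_insert, List.mem_toFinset] at hs
    rw [Perm.mul_apply]
    rcases hs with rfl | hs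
    · rw [hP.invol]
      have hsplit : L = [] ++ a :: (X' ++ π a :: W') := by rw [hLeq]; rfl
      have hN' : ([] ++ a :: (X' ++ π a :: W')).Nodup := hsplit ▸ hP.nodup
      rw [hsplit, formPerm_apply_of_split _ _ _ hN', List.append_nil]
      rcases hX : X' with - | ⟨c, X''⟩
      · simp [hS]
      · simp [hS, hX]
    · have hπs := hcl s hs
      obtain ⟨u, v, huv⟩ := List.append_of_mem hπs
      have hsplit : L = (a :: u) ++ π s :: (v ++ π a :: W') := by rw [hLeq, huv]; simp
      have hN' : ((a :: u) ++ π s :: (v ++ π a :: W')).Nodup := hsplit ▸ hP.nodup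
      rw [hsplit, formPerm_apply_of_split _ _ _ hN']
      rcases hv : v with - | ⟨c, v'⟩
      · simp [hS]
      · have hc : c ∈ X' := by rw [huv, hv]; simp
        simp [hS, hc]
  have hSpow : ∀ n : ℕ, ((List.formPerm L * π) ^ n) (π a) ∈ S := by
    intro n
    induction n with
    | zero => simp [hS]
    | succ n ih =>
      rw [pow_succ', Perm.mul_apply]
      exact hSstep _ ih
  have hāL : π a ∈ L := hP.apply_mem haL
  obtain ⟨n, hn⟩ := (hall (π a) hāL a haL).exists_nat_pow_eq
  have haS := hSpow n
  rw [hn, hS, Finset.mem_insert, List.mem_toFinset] at haS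
  rcases haS with h1 | h1
  · exact hP.apply_ne haL h1.symm
  · exact haX h1

omit [Fintype β] in
/-- An involution composed with the transposition of one of its pairs is an involution.
[folklore] -/
theorem _root_.Literature.GroupTheory.CombinatorialGroupTheory.PairingGenus.invol_swap_mul
    {π : Perm β} (hπ : ∀ x, π (π x) = x) (a x : β) :
    (swap a (π a) * π) ((swap a (π a) * π) x) = x := by
  have hc : π * swap a (π a) = swap a (π a) * π := by
    rw [mul_swap_eq_swap_mul, hπ, swap_comm]
  have hππ : π * π = 1 := by ext y; simp [hπ]
  calc (swap a (π a) * π) ((swap a (π a) * π) x)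
      = (swap a (π a) * (π * swap a (π a)) * π) x := by simp [Perm.mul_apply]
    _ = x := by
        rw [hc]
        simp [Perm.mul_apply, hπ]

omit [Fintype β] in
/-- **Handle pattern**: for `L = a X b Y ā Z b̄ W`, the cyclic word `X W Z Y` with the restricted
pairing is again a pattern. [folklore] -/
theorem handle (hP : IsPat L π ℓ) {a b : β} {X Y Z W : List β}
    (hLeq : L = a :: (X ++ b :: (Y ++ π a :: (Z ++ π b :: W)))) :
    IsPat (X ++ W ++ Z ++ Y) (swap a (π a) * swap b (π b) * π) ℓ := by
  set T := X ++ W ++ Z ++ Y with hT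
  have hperm : L.Perm (a :: π a :: b :: π b :: T) := by
    rw [hLeq, List.perm_iff_count]
    intro x
    simp only [List.count_cons, List.count_append, hT]
    omega
  have hN : (a :: π a :: b :: π b :: T).Nodup := hperm.nodup_iff.1 hP.nodup
  simp only [List.nodup_cons, List.mem_cons, not_or] at hN
  obtain ⟨⟨haā, hab, hab', haT⟩, ⟨hāb, hāb', hāT⟩, ⟨hbb', hbT⟩, hb'T, hTN⟩ := hN
  have hmemL : ∀ x, x ∈ L ↔ x = a ∨ x = π a ∨ x = b ∨ x = π b ∨ x ∈ T := by
    intro x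
    rw [hperm.mem_iff]
    simp
  have haL : a ∈ L := (hmemL a).2 (Or.inl rfl)
  have hbL : b ∈ L := (hmemL b).2 (Or.inr (Or.inr (Or.inl rfl)))
  -- values of the new pairing
  set π' := swap a (π a) * swap b (π b) * π with hπ'
  have hgen : ∀ x, x ≠ a → x ≠ π a → x ≠ b → x ≠ π b → π' x = π x := by
    intro x h1 h2 h3 h4
    have i1 : π x ≠ b := fun h => h4 (by rw [← h, hP.invol])
    have i2 : π x ≠ π b := fun h => h3 (π.injective h)
    have i3 : π x ≠ a := fun h => h2 (by rw [← h, hP.invol])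
    have i4 : π x ≠ π a := fun h => h1 (π.injective h)
    rw [hπ', Perm.mul_apply, Perm.mul_apply, swap_apply_of_ne_of_ne i1 i2,
      swap_apply_of_ne_of_ne i3 i4]
  have hfa : π' a = a := by
    rw [hπ', Perm.mul_apply, Perm.mul_apply, swap_apply_of_ne_of_ne hāb hāb', swap_apply_right]
  have hfā : π' (π a) = π a := by
    rw [hπ', Perm.mul_apply, Perm.mul_apply, hP.invol,
      swap_apply_of_ne_of_ne hab hab', swap_apply_left]
  have hfb : π' b = b := by
    rw [hπ', Perm.mul_apply, Perm.mul_apply, swap_apply_right,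
      swap_apply_of_ne_of_ne (Ne.symm hab) (Ne.symm hāb)]
  have hfb' : π' (π b) = π b := by
    rw [hπ', Perm.mul_apply, Perm.mul_apply, hP.invol, swap_apply_left,
      swap_apply_of_ne_of_ne (Ne.symm hab') (Ne.symm hāb')]
  refine ⟨hTN, ?_, ?_, ?_, ?_⟩
  · -- involution
    intro x
    have hb2 : (swap b (π b) * π) a = π a := by
      rw [Perm.mul_apply, swap_apply_of_ne_of_ne hāb hāb']
    have h1 : π' = swap a ((swap b (π b) * π) a) * (swap b (π b) * π) := by
      rw [hb2, hπ', mul_assoc]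
    rw [h1]
    exact invol_swap_mul (fun y => invol_swap_mul hP.invol b y) a x
  · -- identity off `T`
    intro x hx
    by_cases h1 : x = a
    · rw [h1, hfa]
    by_cases h2 : x = π a
    · rw [h2, hfā]
    by_cases h3 : x = b
    · rw [h3, hfb]
    by_cases h4 : x = π b
    · rw [h4, hfb']
    rw [hgen x h1 h2 h3 h4]
    apply hP.apply_of_not_mem
    rw [hmemL]
    tauto
  · -- no fixed point on `T`
    intro x hx
    have hxL : x ∈ L := (hmemL x).2 (by tauto)
    rw [hgen x (fun h => haT (h ▸ hx)) (fun h => hāT (h ▸ hx)) (fun h => hbT (h ▸ hx))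
      (fun h => hb'T (h ▸ hx))]
    exact hP.apply_ne hxL
  · -- labels
    intro x hx
    have hxL : x ∈ L := (hmemL x).2 (by tauto)
    rw [hgen x (fun h => haT (h ▸ hx)) (fun h => hāT (h ▸ hx)) (fun h => hbT (h ▸ hx))
      (fun h => hb'T (h ▸ hx))]
    exact hP.label hxL

omit [Fintype β] [DecidableEq β] in
/-- **The handle identity**: the word of `a X b Y ā Z b̄ W` is a conjugate of
`[E, F] · (X W Z Y)` for explicit `E`, `F`. [folklore] -/
theorem prod_handle (hP : IsPat L π ℓ) {a b : β} {X Y Z W : List β}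
    (hLeq : L = a :: (X ++ b :: (Y ++ π a :: (Z ++ π b :: W)))) :
    ∃ t E F : G, (L.map ℓ).prod =
      t * (E * F * E⁻¹ * F⁻¹ * ((X ++ W ++ Z ++ Y).map ℓ).prod) * t⁻¹ := by
  have haL : a ∈ L := by rw [hLeq]; exact List.mem_cons_self
  have hbL : b ∈ L := by rw [hLeq]; simp
  refine ⟨(Z.map ℓ).prod * (Y.map ℓ).prod,
    ((Y.map ℓ).prod)⁻¹ * ((Z.map ℓ).prod)⁻¹ * ℓ a * (X.map ℓ).prod * ℓ b * (Y.map ℓ).prod,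
    (ℓ a)⁻¹ * (Z.map ℓ).prod * (Y.map ℓ).prod, ?_⟩
  rw [hLeq]
  simp only [List.map_cons, List.map_append, List.prod_cons, List.prod_append,
    hP.label haL, hP.label hbL]
  group

end IsPat

/-- **Theorem U (upper bound)**: the word of a nonempty pattern whose (pairing) genus is at
most `g` — i.e. `2|β| + 2 ≤ 4g + 2·ncl(σπ) + |L|` — is a product of `g` commutators.
Proof by induction on `|L|`: gauge away and contract a non-loop edge (Case A), or split off a
handle along an interlinked pair (Case B). [folklore] -/
theorem isProdComm_of_isPat (n : ℕ) :
    ∀ (L : List β) (π : Perm β) (ℓ : β → G) (g : ℕ), L.length = n → L ≠ [] → IsPat L π ℓ →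
      2 * Fintype.card β + 2 ≤ 4 * g + 2 * ncl (List.formPerm L * π) + L.length →
      IsProdComm g (L.map ℓ).prod := by
  induction n using Nat.strong_induction_on with
  | _ n ih =>
  intro L π ℓ g hn hne hP hinv
  obtain ⟨x₀, xs, rfl⟩ := List.exists_cons_of_ne_nil hne
  have hx₀ : x₀ ∈ x₀ :: xs := List.mem_cons_self
  have h2 := hP.two_le_length hx₀
  have hLcard := hP.length_le_card
  by_cases hlen : (x₀ :: xs).length = 2
  · -- two positions: the word is `ℓ x * (ℓ x)⁻¹ = 1`
    obtain ⟨u, v, huv⟩ := List.length_eq_two.1 hlen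
    have hu : u ∈ x₀ :: xs := by rw [huv]; simp
    have hπu : π u = v := by
      have h1 := hP.apply_mem hu
      have h2 := hP.apply_ne hu
      rw [huv] at h1
      simp only [List.mem_cons, List.not_mem_nil, or_false] at h1
      tauto
    have hw : ((x₀ :: xs).map ℓ).prod = 1 := by
      rw [huv]
      simp [← hπu, hP.label hu]
    rw [hw]
    exact isProdComm_zero_one.mono (Nat.zero_le _)
  have h3 : 3 ≤ (x₀ :: xs).length := by omega
  set L := x₀ :: xs with hL
  have hnclL := hP.ncl_eq
  by_cases hA : 2 ≤ (L.toFinset.image (cls (List.formPerm L * π))).card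
  · -- Case A: contract a non-loop edge after gauging its label away
    obtain ⟨e, he, hns⟩ := exists_not_sameCycle_next hP.nodup hA
    let h : β → G := fun y =>
      if (List.formPerm L * π).SameCycle y (List.formPerm L e) then ℓ e else 1
    have hh : ∀ y, h ((List.formPerm L * π) y) = h y := by
      intro y
      simp only [h, sameCycle_apply_left]
    have hP' : IsPat L π (fun y => h y * ℓ y * (h (List.formPerm L y))⁻¹) := hP.gauge h hh
    have hhe : h e = 1 := by
      dsimp only [h]
      rw [if_neg hns]
    have hhσe : h (List.formPerm L e) = ℓ e := by
      dsimp only [h]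
      rw [if_pos (SameCycle.refl _ _)]
    have hℓ'e : h e * ℓ e * (h (List.formPerm L e))⁻¹ = 1 := by
      rw [hhe, hhσe]
      simp
    have hℓ'ē : h (π e) * ℓ (π e) * (h (List.formPerm L (π e)))⁻¹ = 1 := by
      have := hP'.label he
      change h (π e) * ℓ (π e) * (h (List.formPerm L (π e)))⁻¹ =
        (h e * ℓ e * (h (List.formPerm L e))⁻¹)⁻¹ at this
      rw [this, hℓ'e, inv_one]
    have hw : (L.map fun y => h y * ℓ y * (h (List.formPerm L y))⁻¹).prod =
        h x₀ * (L.map ℓ).prod * (h x₀)⁻¹ :=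
      prod_map_gauge h ℓ x₀ xs hP.nodup
    have hPd := hP'.delete he
    have hlen' := hP'.length_delete he
    have hncl := hP'.ncl_add_one_le_ncl_delete he h3
    have hne' : (L.erase e).erase (π e) ≠ [] := by
      intro h0
      rw [h0] at hlen'
      simp only [List.length_nil] at hlen'
      omega
    have IH := ih ((L.erase e).erase (π e)).length (by omega) ((L.erase e).erase (π e)) _
      (fun y => h y * ℓ y * (h (List.formPerm L y))⁻¹) g rfl hne' hPd (by omega)
    have hw' : (((L.erase e).erase (π e)).map fun y => h y * ℓ y * (h (List.formPerm L y))⁻¹).prod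
        = (L.map fun y => h y * ℓ y * (h (List.formPerm L y))⁻¹).prod := by
      rw [prod_map_erase_of_eq_one (ℓ := fun y => h y * ℓ y * (h (List.formPerm L y))⁻¹)
          (hP.nodup.erase e) hℓ'ē,
        prod_map_erase_of_eq_one (ℓ := fun y => h y * ℓ y * (h (List.formPerm L y))⁻¹)
          hP.nodup hℓ'e]
    rw [hw', hw] at IH
    have := IH.conj (h x₀)⁻¹
    simpa [mul_assoc] using this
  · -- Case B: one vertex; split off a handle
    have hall : ∀ x ∈ L, ∀ y ∈ L, (List.formPerm L * π).SameCycle x y := by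
      intro x hx y hy
      by_contra hxy
      exact hA (two_le_card_image_cls (List.mem_toFinset.2 hx) (List.mem_toFinset.2 hy) hxy)
    have hcard1 : (L.toFinset.image (cls (List.formPerm L * π))).card = 1 := by
      have := one_le_card_image_cls (List.formPerm L * π) (S := L.toFinset)
        ⟨x₀, List.mem_toFinset.2 hx₀⟩
      omega
    have hL4g : L.length ≤ 4 * g := by
      rw [hnclL, hcard1] at hinv
      omega
    have hg : 1 ≤ g := by omega
    -- decompose `L = a X b Y ā Z b̄ W`
    have hāL : π x₀ ∈ L := hP.apply_mem hx₀
    have hā : π x₀ ∈ xs := by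
      have hne := hP.apply_ne hx₀
      simp only [hL, List.mem_cons] at hāL
      tauto
    obtain ⟨X', W', hXW⟩ := List.append_of_mem hā
    have hLeq1 : L = x₀ :: (X' ++ π x₀ :: W') := by rw [hL, hXW]
    obtain ⟨b, hb, hb'⟩ := hP.exists_interlinked hLeq1 hall
    obtain ⟨X, Y, hXY⟩ := List.append_of_mem hb
    obtain ⟨Z, W, hZW⟩ := List.append_of_mem hb'
    have hLeq : L = x₀ :: (X ++ b :: (Y ++ π x₀ :: (Z ++ π b :: W))) := by
      rw [hLeq1, hXY, hZW]
      simp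
    have hPT := hP.handle hLeq
    have hlenT := length_handle hLeq
    obtain ⟨t, E, F, hword⟩ := hP.prod_handle hLeq
    set T := X ++ W ++ Z ++ Y with hT
    rw [hword]
    apply IsProdComm.conj
    have hg1 : g = (g - 1) + 1 := by omega
    rw [hg1]
    apply IsProdComm.comm_mul
    by_cases hTnil : T = []
    · rw [hTnil]
      simp only [List.map_nil, List.prod_nil]
      exact isProdComm_zero_one.mono (Nat.zero_le _)
    · have hnclT := hPT.card_sub_length_lt_ncl hTnil
      exact ih T.length (by omega) T _ ℓ (g - 1) rfl hTnil hPT (by omega)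

/-- Products of singleton classes give the class of the word. [folklore] -/
theorem prod_map_mk_singleton {α : Type*} (w : List (α × Bool)) :
    (w.map fun d => FreeGroup.mk [d]).prod = FreeGroup.mk w := by
  induction w with
  | nil => rfl
  | cons d w ih => rw [List.map_cons, List.prod_cons, ih, FreeGroup.mul_mk, List.singleton_append]

/-- **Upper bound for a concrete pairing**: for a pairing `π` of `w` with `o` orbits of `σπ`,
`cl(w) ≤ g` whenever `|w| + 2 ≤ 4g + 2o` (i.e. the genus of `π` is at most `g`). [folklore] -/
theorem commutatorLength_le_of_isPairing {α : Type*} [DecidableEq α] (w : List (α × Bool))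
    (hw : w ≠ []) (π : Perm (Fin w.length)) (hπ : IsPairing w π) (g : ℕ)
    (hg : w.length + 2 ≤ 4 * g + 2 * orbitCount ((finRotate w.length).trans π)) :
    commutatorLength (FreeGroup.mk w) ≤ g := by
  -- the pattern on `Fin |w|`
  have hP : IsPat (List.finRange w.length) π (fun i => FreeGroup.mk [w.get i]) := by
    refine ⟨List.nodup_finRange _, hπ.1, fun x hx => absurd (List.mem_finRange x) hx,
      fun x _ => hπ.2.1 x, fun x _ => ?_⟩
    dsimp only
    rw [hπ.2.2 x, FreeGroup.inv_mk]
    rfl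
  have hword : ((List.finRange w.length).map fun i => FreeGroup.mk [w.get i]).prod =
      FreeGroup.mk w := by
    have : (List.finRange w.length).map (fun i => FreeGroup.mk [w.get i]) =
        ((List.finRange w.length).map w.get).map fun d => FreeGroup.mk [d] := by
      rw [List.map_map]
      rfl
    rw [this, ← List.ofFn_eq_map, List.ofFn_get, prod_map_mk_singleton]
  have hne : List.finRange w.length ≠ [] := by
    intro h
    have : (List.finRange w.length).length = 0 := by rw [h]; rfl
    rw [List.length_finRange] at this
    exact hw (List.length_eq_zero_iff.1 this)
  have hncl : orbitCount ((finRotate w.length).trans π) =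
      ncl (List.formPerm (List.finRange w.length) * π) := by
    rw [orbitCount_eq_ncl, formPerm_finRange]
    have : (finRotate w.length).trans π = π * (finRotate w.length * π) * π⁻¹ := by
      rw [show (finRotate w.length).trans π = π * finRotate w.length from rfl]
      group
    rw [this, ncl_conj]
  have h := isProdComm_of_isPat (G := FreeGroup α) w.length (List.finRange w.length) π
    (fun i => FreeGroup.mk [w.get i]) g (List.length_finRange) hne hP (by
      rw [← hncl, List.length_finRange, Fintype.card_fin]
      omega)
  rw [hword] at h
  exact h.commutatorLength_le

end Upper

/-! ### Moves for the lower bound: subdivision, repair, appending a commutator block -/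

section LowerMoves

variable {β : Type*} [Fintype β] [DecidableEq β] {G : Type*} [Group G]

omit [Fintype β] in
/-- An involution composed with a transposition of two of its fixed points is an involution.
[folklore] -/
theorem invol_swap_mul_of_fixed {π : Perm β} (hπ : ∀ x, π (π x) = x) {a a' : β} (ha : π a = a)
    (ha' : π a' = a') (x : β) : (swap a a' * π) ((swap a a' * π) x) = x := by
  have hc : π * swap a a' = swap a a' * π := by
    rw [mul_swap_eq_swap_mul, ha, ha']
  calc (swap a a' * π) ((swap a a' * π) x)
      = (swap a a' * (π * swap a a') * π) x := by simp [Perm.mul_apply]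
    _ = x := by
        rw [hc]
        simp [Perm.mul_apply, hπ]

namespace IsPat

variable {L : List β} {π : Perm β} {ℓ : β → G}

/-- **Subdivision move**: split the position `e` (label `p * q`) into two consecutive positions
labelled `p`, `q` (and its partner into `q⁻¹`, `p⁻¹`), using two fresh positions `c`, `c'`.
The new pattern has the same word, two more positions, and loses at most one ambient orbit
(i.e. gains a vertex). [folklore] -/
theorem exists_subdivide (hP : IsPat L π ℓ) {e : β} (he : e ∈ L) {c c' : β} (hc : c ∉ L)
    (hc' : c' ∉ L) (hcc' : c ≠ c') (p q : G) (hpq : ℓ e = p * q) :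
    ∃ (L' : List β) (π' : Perm β) (ℓ' : β → G), IsPat L' π' ℓ' ∧ L'.Perm (c :: c' :: L) ∧
      (L'.map ℓ').prod = (L.map ℓ).prod ∧
      ncl (List.formPerm L * π) ≤ ncl (List.formPerm L' * π') + 1 ∧
      ℓ' e = p ∧ ℓ' c = q ∧ ℓ' c' = q⁻¹ ∧ ℓ' (π e) = p⁻¹ ∧
      (∀ x ∈ L, x ≠ e → x ≠ π e → ℓ' x = ℓ x) := by
  -- names and distinctness
  have hēL : π e ∈ L := hP.apply_mem he
  have heē : e ≠ π e := (hP.apply_ne he).symm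
  have hec : e ≠ c := fun h => hc (h ▸ he)
  have hec' : e ≠ c' := fun h => hc' (h ▸ he)
  have hēc : π e ≠ c := fun h => hc (h ▸ hēL)
  have hēc' : π e ≠ c' := fun h => hc' (h ▸ hēL)
  have hπc : π c = c := hP.apply_of_not_mem hc
  have hπc' : π c' = c' := hP.apply_of_not_mem hc'
  have hσc : List.formPerm L c = c := List.formPerm_apply_of_notMem hc
  have hσc' : List.formPerm L c' = c' := List.formPerm_apply_of_notMem hc'
  -- the intermediate list `L₁` (insert `c'` before `π e`)
  obtain ⟨m₁, m₂, hm⟩ := List.append_of_mem hēL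
  set L₁ := m₁ ++ c' :: π e :: m₂ with hL₁
  have hL₁N : L₁.Nodup := by
    rw [hL₁, List.nodup_middle, List.nodup_cons, ← hm]
    exact ⟨hc', hP.nodup⟩
  have hmemL₁ : ∀ x, x ∈ L₁ ↔ x = c' ∨ x ∈ L := by
    intro x
    rw [hL₁, (List.perm_middle).mem_iff, List.mem_cons, hm]
  have hc'm₁ : c' ∉ m₁ := fun h => hc' (by rw [hm]; exact List.mem_append_left _ h)
  have hL₁erase : L₁.erase c' = L := by
    rw [hL₁, List.erase_append_right _ hc'm₁, List.erase_cons_head, hm]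
  have hσ₁c' : List.formPerm L₁ c' = π e := by
    rw [hL₁, formPerm_apply_of_split _ _ _ (hL₁ ▸ hL₁N)]
    rfl
  have hσ₁ : List.formPerm L₁ = swap c' (π e) * List.formPerm L := by
    have h1 := formPerm_erase hL₁N ((hmemL₁ c').2 (Or.inl rfl))
    rw [hL₁erase, hσ₁c'] at h1
    rw [h1, swap_mul_self_mul]
  -- the final list `L'` (insert `c` after `e`)
  have heL₁ : e ∈ L₁ := (hmemL₁ e).2 (Or.inr he)
  obtain ⟨l₁, l₂, hl⟩ := List.append_of_mem heL₁
  set L' := l₁ ++ e :: c :: l₂ with hL'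
  have hcL₁ : c ∉ L₁ := by
    rw [hmemL₁]
    rintro (h | h)
    · exact hcc' h
    · exact hc h
  have hL'eq : L' = (l₁ ++ [e]) ++ c :: l₂ := by rw [hL']; simp
  have hL'N : L'.Nodup := by
    rw [hL'eq, List.nodup_middle, List.nodup_cons]
    have : l₁ ++ [e] ++ l₂ = L₁ := by rw [hl]; simp
    rw [this]
    exact ⟨hcL₁, hL₁N⟩
  have hpermL' : L'.Perm (c :: c' :: L) := by
    have h1 : L'.Perm (c :: L₁) := by
      rw [hL'eq]
      refine (List.perm_middle).trans ?_
      rw [hl]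
      simp
    refine h1.trans (List.Perm.cons c ?_)
    rw [hL₁, hm]
    exact List.perm_middle
  have hmemL' : ∀ x, x ∈ L' ↔ x = c ∨ x = c' ∨ x ∈ L := by
    intro x
    rw [hpermL'.mem_iff]
    simp
  have hcl₁ : c ∉ l₁ ++ [e] := by
    intro h
    rw [List.mem_append, List.mem_singleton] at h
    rcases h with h | h
    · exact hcL₁ (by rw [hl]; exact List.mem_append_left _ h)
    · exact hec h.symm
  have hL'erase : L'.erase c = L₁ := by
    rw [hL'eq, List.erase_append_right _ hcl₁, List.erase_cons_head, hl]
    simp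
  have hσ'c : List.formPerm L' c = List.formPerm L₁ e := by
    rw [hL'eq, formPerm_apply_of_split _ _ _ (hL'eq ▸ hL'N), hl,
      formPerm_apply_of_split _ _ _ (hl ▸ hL₁N), ← List.append_assoc, head?_append_singleton_getD]
  have hσ' : List.formPerm L' = swap c (List.formPerm L₁ e) * List.formPerm L₁ := by
    have h1 := formPerm_erase hL'N ((hmemL' c).2 (Or.inl rfl))
    rw [hL'erase, hσ'c] at h1
    set X := List.formPerm L₁ e with hX
    rw [h1, swap_mul_self_mul]
  -- the new pairing and labels
  set π' := swap c c' * π with hπ'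
  set ℓ' : β → G := fun x =>
    if x = e then p else if x = c then q else if x = c' then q⁻¹ else if x = π e then p⁻¹ else ℓ x
    with hℓ'
  have hℓ'e : ℓ' e = p := by simp [hℓ']
  have hℓ'c : ℓ' c = q := by simp [hℓ', hec.symm]
  have hℓ'c' : ℓ' c' = q⁻¹ := by simp [hℓ', hec'.symm, hcc'.symm]
  have hℓ'ē : ℓ' (π e) = p⁻¹ := by simp [hℓ', heē.symm, hēc, hēc']
  have hℓ'o : ∀ x, x ≠ e → x ≠ c → x ≠ c' → x ≠ π e → ℓ' x = ℓ x := by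
    intro x h1 h2 h3 h4
    simp [hℓ', h1, h2, h3, h4]
  have hπ'c : π' c = c' := by rw [hπ', Perm.mul_apply, hπc, swap_apply_left]
  have hπ'c' : π' c' = c := by rw [hπ', Perm.mul_apply, hπc', swap_apply_right]
  have hπ'L : ∀ x ∈ L, π' x = π x := by
    intro x hx
    have hπx := hP.apply_mem hx
    have h1 : π x ≠ c := fun h => hc (h ▸ hπx)
    have h2 : π x ≠ c' := fun h => hc' (h ▸ hπx)
    rw [hπ', Perm.mul_apply, swap_apply_of_ne_of_ne h1 h2]
  have hP' : IsPat L' π' ℓ' := by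
    refine ⟨hL'N, invol_swap_mul_of_fixed hP.invol hπc hπc', ?_, ?_, ?_⟩
    · intro x hx
      rw [hmemL'] at hx
      simp only [not_or] at hx
      obtain ⟨h1, h2, h3⟩ := hx
      rw [hπ', Perm.mul_apply, hP.apply_of_not_mem h3, swap_apply_of_ne_of_ne h1 h2]
    · intro x hx
      rw [hmemL'] at hx
      rcases hx with rfl | rfl | hx
      · rw [hπ'c]; exact hcc'.symm
      · rw [hπ'c']; exact hcc'
      · rw [hπ'L x hx]; exact hP.apply_ne hx
    · intro x hx
      rw [hmemL'] at hx
      rcases hx with rfl | rfl | hx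
      · rw [hπ'c, hℓ'c', hℓ'c]
      · rw [hπ'c', hℓ'c, hℓ'c', inv_inv]
      · rw [hπ'L x hx]
        by_cases h1 : x = e
        · rw [h1, hℓ'ē, hℓ'e]
        by_cases h4 : x = π e
        · rw [h4, hP.invol, hℓ'e, hℓ'ē, inv_inv]
        have h2 : x ≠ c := fun h => hc (h ▸ hx)
        have h3 : x ≠ c' := fun h => hc' (h ▸ hx)
        have hπx := hP.apply_mem hx
        have g1 : π x ≠ e := fun h => h4 (by rw [← h, hP.invol])
        have g2 : π x ≠ c := fun h => hc (h ▸ hπx)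
        have g3 : π x ≠ c' := fun h => hc' (h ▸ hπx)
        have g4 : π x ≠ π e := fun h => h1 (π.injective h)
        rw [hℓ'o x h1 h2 h3 h4, hℓ'o (π x) g1 g2 g3 g4, hP.label hx]
  -- the word
  have hword : (L'.map ℓ').prod = (L.map ℓ).prod := by
    -- labels for `L₁`
    let ℓ₁ : β → G := fun x => if x = c' then q⁻¹ else if x = π e then p⁻¹ else ℓ x
    have hagree : ∀ x ∈ L₁, x ≠ e → ℓ' x = ℓ₁ x := by
      intro x hx hxe
      have hxc : x ≠ c := fun h => hcL₁ (h ▸ hx)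
      simp [hℓ', ℓ₁, hxe, hxc]
    have hl₁ : ∀ x ∈ l₁, ℓ' x = ℓ₁ x := by
      intro x hx
      refine hagree x (by rw [hl]; exact List.mem_append_left _ hx) ?_
      rintro rfl
      have := hl ▸ hL₁N
      rw [List.nodup_middle, List.nodup_cons] at this
      exact this.1 (List.mem_append_left _ hx)
    have hl₂ : ∀ x ∈ l₂, ℓ' x = ℓ₁ x := by
      intro x hx
      refine hagree x (by rw [hl]; simp [hx]) ?_
      rintro rfl
      have := hl ▸ hL₁N
      rw [List.nodup_middle, List.nodup_cons] at this
      exact this.1 (List.mem_append_right _ hx)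
    have hℓ₁e : ℓ₁ e = ℓ e := by simp [ℓ₁, hec', heē]
    have step1 : (L'.map ℓ').prod = (L₁.map ℓ₁).prod := by
      rw [hL', hl]
      simp only [List.map_append, List.map_cons, List.prod_append, List.prod_cons,
        List.map_congr_left hl₁, List.map_congr_left hl₂, hℓ'e, hℓ'c, hℓ₁e, hpq, mul_assoc]
    have hm₁ : ∀ x ∈ m₁, ℓ₁ x = ℓ x := by
      intro x hx
      have hxL : x ∈ L := by rw [hm]; exact List.mem_append_left _ hx
      have h1 : x ≠ c' := fun h => hc' (h ▸ hxL)
      have h2 : x ≠ π e := by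
        rintro rfl
        have := hm ▸ hP.nodup
        rw [List.nodup_middle, List.nodup_cons] at this
        exact this.1 (List.mem_append_left _ hx)
      simp [ℓ₁, h1, h2]
    have hm₂ : ∀ x ∈ m₂, ℓ₁ x = ℓ x := by
      intro x hx
      have hxL : x ∈ L := by rw [hm]; simp [hx]
      have h1 : x ≠ c' := fun h => hc' (h ▸ hxL)
      have h2 : x ≠ π e := by
        rintro rfl
        have := hm ▸ hP.nodup
        rw [List.nodup_middle, List.nodup_cons] at this
        exact this.1 (List.mem_append_right _ hx)
      simp [ℓ₁, h1, h2]
    have hℓ₁c' : ℓ₁ c' = q⁻¹ := by simp [ℓ₁]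
    have hℓ₁ē : ℓ₁ (π e) = p⁻¹ := by simp [ℓ₁, hēc']
    have step2 : (L₁.map ℓ₁).prod = (L.map ℓ).prod := by
      rw [hL₁]
      conv_rhs => rw [hm]
      simp only [List.map_append, List.map_cons, List.prod_append, List.prod_cons,
        List.map_congr_left hm₁, List.map_congr_left hm₂, hℓ₁c', hℓ₁ē, hP.label he, hpq,
        mul_inv_rev, mul_assoc]
    rw [step1, step2]
  -- the orbit count
  have hncl : ncl (List.formPerm L * π) ≤ ncl (List.formPerm L' * π') + 1 := by
    set σ := List.formPerm L with hσ
    set ρ := σ * π with hρ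
    set ρ₁ := swap c c' * ρ with hρ₁
    set ρ₂ := swap c' (π e) * ρ₁ with hρ₂
    have hX : List.formPerm L₁ e = swap c' (π e) (σ e) := by rw [hσ₁, Perm.mul_apply]
    have key : List.formPerm L' * π' = swap c (swap c' (π e) (σ e)) * ρ₂ := by
      rw [hσ', hX, hσ₁, hπ', hρ₂, hρ₁, hρ]
      have : σ * swap c c' = swap c c' * σ := by
        rw [mul_swap_eq_swap_mul, hσc, hσc']
      simp only [mul_assoc]
      rw [← mul_assoc σ, this, mul_assoc]
    rw [key]
    have s1 : ncl ρ ≤ ncl ρ₁ + 1 := ncl_le_ncl_swap_mul_add_one ρ c c'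
    have s2 : ncl ρ₁ ≤ ncl ρ₂ + 1 := ncl_le_ncl_swap_mul_add_one ρ₁ c' (π e)
    have hρ₂c : ρ₂ c = π e := by
      simp only [hρ₂, hρ₁, hρ, Perm.mul_apply, hπc, hσc, swap_apply_left]
    have hσeL : σ e ∈ L := by
      rw [hσ, List.formPerm_mem_iff_mem]
      exact he
    have hσec : σ e ≠ c := fun h => hc (h ▸ hσeL)
    have hσec' : σ e ≠ c' := fun h => hc' (h ▸ hσeL)
    have hρ₂ē : ρ₂ (π e) = swap c' (π e) (σ e) := by
      simp only [hρ₂, hρ₁, hρ, Perm.mul_apply, hP.invol]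
      rw [swap_apply_of_ne_of_ne hσec hσec']
    have s3 : ncl ρ₂ + 1 ≤ ncl (swap c (swap c' (π e) (σ e)) * ρ₂) := by
      apply ncl_add_one_le_ncl_swap_mul
      · intro h
        by_cases h1 : σ e = π e
        · rw [h1, swap_apply_right] at h
          exact hcc' h
        · rw [swap_apply_of_ne_of_ne hσec' h1] at h
          exact hσec h.symm
      · rw [← hρ₂ē, ← hρ₂c]
        exact (sameCycle_apply_right.2 (sameCycle_apply_right.2 (SameCycle.refl _ _)))
    omega
  exact ⟨L', π', ℓ', hP', hpermL', hword, hncl, hℓ'e, hℓ'c, hℓ'c', hℓ'ē,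
    fun x hx h1 h4 => hℓ'o x h1 (fun h => hc (h ▸ hx)) (fun h => hc' (h ▸ hx)) h4⟩

/-- **Repair move**: if two consecutive positions `x`, `y` carry inverse labels but are not
paired, re-pair `x ↔ y` and `π x ↔ π y`; this is again a pattern and does not lose orbits.
[folklore] -/
theorem repair (hP : IsPat L π ℓ) {l₁ l₂ : List β} {x y : β} (hLeq : L = l₁ ++ x :: y :: l₂)
    (hxy : ℓ y = (ℓ x)⁻¹) (hπx : π x ≠ y) :
    IsPat L (swap (π x) y * swap x (π y) * π) ℓ ∧ (swap (π x) y * swap x (π y) * π) x = y ∧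
      ncl (List.formPerm L * π) ≤ ncl (List.formPerm L * (swap (π x) y * swap x (π y) * π)) := by
  have hxL : x ∈ L := by rw [hLeq]; simp
  have hyL : y ∈ L := by rw [hLeq]; simp
  have hxy' : x ≠ y := by
    rintro rfl
    have := hLeq ▸ hP.nodup
    rw [List.nodup_middle, List.nodup_cons] at this
    exact this.1 (by simp)
  have hπxL := hP.apply_mem hxL
  have hπyL := hP.apply_mem hyL
  have hπxx : π x ≠ x := hP.apply_ne hxL
  have hπyy : π y ≠ y := hP.apply_ne hyL
  have hπyx : π y ≠ x := fun h => hπx (by rw [← h, hP.invol])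
  have hπxπy : π x ≠ π y := fun h => hxy' (π.injective h)
  set π' := swap (π x) y * swap x (π y) * π with hπ'
  -- values
  have vx : π' x = y := by
    rw [hπ', Perm.mul_apply, Perm.mul_apply, swap_apply_of_ne_of_ne hπxx hπxπy, swap_apply_left]
  have vy : π' y = x := by
    rw [hπ', Perm.mul_apply, Perm.mul_apply, swap_apply_right,
      swap_apply_of_ne_of_ne hπxx.symm hxy']
  have vπx : π' (π x) = π y := by
    rw [hπ', Perm.mul_apply, Perm.mul_apply, hP.invol, swap_apply_left,
      swap_apply_of_ne_of_ne hπxπy.symm hπyy]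
  have vπy : π' (π y) = π x := by
    rw [hπ', Perm.mul_apply, Perm.mul_apply, hP.invol,
      swap_apply_of_ne_of_ne hxy'.symm hπyy.symm, swap_apply_right]
  have vo : ∀ z, z ≠ x → z ≠ y → z ≠ π x → z ≠ π y → π' z = π z := by
    intro z h1 h2 h3 h4
    have i1 : π z ≠ x := fun h => h3 (by rw [← h, hP.invol])
    have i2 : π z ≠ π y := fun h => h2 (π.injective h)
    have i3 : π z ≠ π x := fun h => h1 (π.injective h)
    have i4 : π z ≠ y := fun h => h4 (by rw [← h, hP.invol])
    rw [hπ', Perm.mul_apply, Perm.mul_apply, swap_apply_of_ne_of_ne i1 i2,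
      swap_apply_of_ne_of_ne i3 i4]
  have hinv : ∀ z, π' (π' z) = z := by
    intro z
    by_cases h1 : z = x
    · rw [h1, vx, vy]
    by_cases h2 : z = y
    · rw [h2, vy, vx]
    by_cases h3 : z = π x
    · rw [h3, vπx, vπy]
    by_cases h4 : z = π y
    · rw [h4, vπy, vπx]
    have i1 : π z ≠ x := fun h => h3 (by rw [← h, hP.invol])
    have i2 : π z ≠ π y := fun h => h2 (π.injective h)
    have i3 : π z ≠ π x := fun h => h1 (π.injective h)
    have i4 : π z ≠ y := fun h => h4 (by rw [← h, hP.invol])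
    rw [vo z h1 h2 h3 h4, vo (π z) i1 i4 i3 i2, hP.invol]
  have hP' : IsPat L π' ℓ := by
    refine ⟨hP.nodup, hinv, ?_, ?_, ?_⟩
    · intro z hz
      rw [vo z (fun h => hz (h ▸ hxL)) (fun h => hz (h ▸ hyL)) (fun h => hz (h ▸ hπxL))
        (fun h => hz (h ▸ hπyL))]
      exact hP.apply_of_not_mem hz
    · intro z hz
      by_cases h1 : z = x
      · rw [h1, vx]; exact hxy'.symm
      by_cases h2 : z = y
      · rw [h2, vy]; exact hxy'
      by_cases h3 : z = π x
      · rw [h3, vπx]; exact hπxπy.symm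
      by_cases h4 : z = π y
      · rw [h4, vπy]; exact hπxπy
      rw [vo z h1 h2 h3 h4]
      exact hP.apply_ne hz
    · intro z hz
      by_cases h1 : z = x
      · rw [h1, vx, hxy]
      by_cases h2 : z = y
      · rw [h2, vy, hxy, inv_inv]
      by_cases h3 : z = π x
      · rw [h3, vπx, hP.label hyL, hP.label hxL, hxy, inv_inv]
      by_cases h4 : z = π y
      · rw [h4, vπy, hP.label hxL, hP.label hyL, hxy, inv_inv]
      rw [vo z h1 h2 h3 h4]
      exact hP.label hz
  refine ⟨hP', vx, ?_⟩
  -- orbit count: `ρ' = swap (σ (π x)) (σ y) * (swap y (σ (π y)) * ρ)`, a `≥ -1` step after a split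
  set σ := List.formPerm L with hσ
  have hσx : σ x = y := by
    rw [hσ, hLeq, formPerm_apply_of_split _ _ _ (hLeq ▸ hP.nodup)]
    rfl
  have e1 : σ * swap (π x) y = swap (σ (π x)) (σ y) * σ := mul_swap_eq_swap_mul σ (π x) y
  have e2 : σ * swap x (π y) = swap y (σ (π y)) * σ := by rw [mul_swap_eq_swap_mul, hσx]
  have key : σ * π' = swap (σ (π x)) (σ y) * (swap y (σ (π y)) * (σ * π)) := by
    rw [hπ', ← mul_assoc, ← mul_assoc, e1, mul_assoc _ σ (swap x (π y)), e2]
    simp only [mul_assoc]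
  rw [key]
  have s1 : ncl (σ * π) + 1 ≤ ncl (swap y (σ (π y)) * (σ * π)) := by
    have hρy : (σ * π) y = σ (π y) := Perm.mul_apply _ _ _
    apply ncl_add_one_le_ncl_swap_mul
    · -- `y ≠ σ (π y)` since `σ (π y) = y = σ x` would force `π y = x`
      intro h
      apply hπyx
      apply σ.injective
      rw [hσx]
      exact h.symm
    · rw [← hρy]
      exact sameCycle_apply_right.2 (SameCycle.refl _ _)
  have s2 := ncl_le_ncl_swap_mul_add_one (swap y (σ (π y)) * (σ * π)) (σ (π x)) (σ y)
  omega

omit [Fintype β] in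
/-- After a repair, deleting the now-paired consecutive positions `x`, `y = π x` removes exactly
them from the list. [folklore] -/
theorem delete_consecutive_eq {l₁ l₂ : List β} {x : β} (hP : IsPat L π ℓ)
    (hLeq : L = l₁ ++ x :: π x :: l₂) : (L.erase x).erase (π x) = l₁ ++ l₂ := by
  have hN := hLeq ▸ hP.nodup
  rw [List.nodup_middle, List.nodup_cons] at hN
  have hx1 : x ∉ l₁ := fun h => hN.1 (List.mem_append_left _ h)
  have hN2 := hN.2
  rw [List.nodup_middle, List.nodup_cons] at hN2
  have hπx1 : π x ∉ l₁ := fun h => hN2.1 (List.mem_append_left _ h)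
  rw [hLeq, List.erase_append_right _ hx1, List.erase_cons_head, List.erase_append_right _ hπx1,
    List.erase_cons_head]

omit [Fintype β] in
/-- **Appending a commutator block**: four fresh positions `a b a' b'` with labels
`u v u⁻¹ v⁻¹` appended to a pattern give a pattern whose word is multiplied by `[u, v]`.
[folklore] -/
theorem exists_append_block (hP : IsPat L π ℓ) {a b a' b' : β} (ha : a ∉ L) (hb : b ∉ L)
    (ha' : a' ∉ L) (hb' : b' ∉ L) (hab : a ≠ b) (haa' : a ≠ a') (hab' : a ≠ b') (hba' : b ≠ a')
    (hbb' : b ≠ b') (ha'b' : a' ≠ b') (u v : G) :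
    ∃ (π' : Perm β) (ℓ' : β → G), IsPat (L ++ [a, b, a', b']) π' ℓ' ∧
      ((L ++ [a, b, a', b']).map ℓ').prod = (L.map ℓ).prod * (u * v * u⁻¹ * v⁻¹) ∧
      (∀ x ∈ L, ℓ' x = ℓ x) ∧ ℓ' a = u ∧ ℓ' b = v ∧ ℓ' a' = u⁻¹ ∧ ℓ' b' = v⁻¹ := by
  have hπa : π a = a := hP.apply_of_not_mem ha
  have hπb : π b = b := hP.apply_of_not_mem hb
  have hπa' : π a' = a' := hP.apply_of_not_mem ha'
  have hπb' : π b' = b' := hP.apply_of_not_mem hb'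
  set π₂ := swap b b' * π with hπ₂
  have hπ₂inv : ∀ x, π₂ (π₂ x) = x := invol_swap_mul_of_fixed hP.invol hπb hπb'
  have hπ₂a : π₂ a = a := by rw [hπ₂, Perm.mul_apply, hπa, swap_apply_of_ne_of_ne hab hab']
  have hπ₂a' : π₂ a' = a' := by
    rw [hπ₂, Perm.mul_apply, hπa', swap_apply_of_ne_of_ne hba'.symm ha'b']
  set π' := swap a a' * π₂ with hπ'
  set ℓ' : β → G := fun x =>
    if x = a then u else if x = b then v else if x = a' then u⁻¹ else if x = b' then v⁻¹ else ℓ x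
    with hℓ'
  have la : ℓ' a = u := by simp [hℓ']
  have lb : ℓ' b = v := by simp [hℓ', hab.symm]
  have la' : ℓ' a' = u⁻¹ := by simp [hℓ', haa'.symm, hba'.symm]
  have lb' : ℓ' b' = v⁻¹ := by simp [hℓ', hab'.symm, hbb'.symm, ha'b'.symm]
  have lo : ∀ x ∈ L, ℓ' x = ℓ x := by
    intro x hx
    have h1 : x ≠ a := fun h => ha (h ▸ hx)
    have h2 : x ≠ b := fun h => hb (h ▸ hx)
    have h3 : x ≠ a' := fun h => ha' (h ▸ hx)
    have h4 : x ≠ b' := fun h => hb' (h ▸ hx)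
    simp [hℓ', h1, h2, h3, h4]
  have va : π' a = a' := by rw [hπ', Perm.mul_apply, hπ₂a, swap_apply_left]
  have va' : π' a' = a := by rw [hπ', Perm.mul_apply, hπ₂a', swap_apply_right]
  have vb : π' b = b' := by
    rw [hπ', Perm.mul_apply, hπ₂, Perm.mul_apply, hπb, swap_apply_left,
      swap_apply_of_ne_of_ne hab'.symm ha'b'.symm]
  have vb' : π' b' = b := by
    rw [hπ', Perm.mul_apply, hπ₂, Perm.mul_apply, hπb', swap_apply_right,
      swap_apply_of_ne_of_ne hab.symm hba']
  have vL : ∀ x ∈ L, π' x = π x := by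
    intro x hx
    have hπx := hP.apply_mem hx
    have h1 : π x ≠ b := fun h => hb (h ▸ hπx)
    have h2 : π x ≠ b' := fun h => hb' (h ▸ hπx)
    have h3 : π x ≠ a := fun h => ha (h ▸ hπx)
    have h4 : π x ≠ a' := fun h => ha' (h ▸ hπx)
    rw [hπ', Perm.mul_apply, hπ₂, Perm.mul_apply, swap_apply_of_ne_of_ne h1 h2,
      swap_apply_of_ne_of_ne h3 h4]
  have vo : ∀ x, x ∉ L → x ≠ a → x ≠ b → x ≠ a' → x ≠ b' → π' x = x := by
    intro x hx h1 h2 h3 h4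
    rw [hπ', Perm.mul_apply, hπ₂, Perm.mul_apply, hP.apply_of_not_mem hx,
      swap_apply_of_ne_of_ne h2 h4, swap_apply_of_ne_of_ne h1 h3]
  have hmem : ∀ x, x ∈ L ++ [a, b, a', b'] ↔ x ∈ L ∨ x = a ∨ x = b ∨ x = a' ∨ x = b' := by
    intro x
    simp
  refine ⟨π', ℓ', ⟨?_, invol_swap_mul_of_fixed hπ₂inv hπ₂a hπ₂a', ?_, ?_, ?_⟩, ?_, lo, la, lb,
    la', lb'⟩
  · rw [List.nodup_append]
    refine ⟨hP.nodup, by simp [hab, haa', hab', hba', hbb', ha'b'], ?_⟩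
    intro x hx y hy
    simp only [List.mem_cons, List.not_mem_nil, or_false] at hy
    rcases hy with rfl | rfl | rfl | rfl
    · exact fun h => ha (h ▸ hx)
    · exact fun h => hb (h ▸ hx)
    · exact fun h => ha' (h ▸ hx)
    · exact fun h => hb' (h ▸ hx)
  · intro x hx
    rw [hmem] at hx
    simp only [not_or] at hx
    exact vo x hx.1 hx.2.1 hx.2.2.1 hx.2.2.2.1 hx.2.2.2.2
  · intro x hx
    rw [hmem] at hx
    rcases hx with hx | rfl | rfl | rfl | rfl
    · rw [vL x hx]; exact hP.apply_ne hx
    · rw [va]; exact haa'.symm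
    · rw [vb]; exact hbb'.symm
    · rw [va']; exact haa'
    · rw [vb']; exact hbb'
  · intro x hx
    rw [hmem] at hx
    rcases hx with hx | rfl | rfl | rfl | rfl
    · rw [vL x hx, lo x hx, lo _ (hP.apply_mem hx)]; exact hP.label hx
    · rw [va, la', la]
    · rw [vb, lb', lb]
    · rw [va', la, la', inv_inv]
    · rw [vb', lb, lb', inv_inv]
  · rw [List.map_append, List.prod_append, List.map_congr_left lo]
    simp [la, lb, la', lb', mul_assoc]

end IsPat

/-- Two fresh points exist off a short list. [folklore] -/
theorem exists_two_not_mem (L : List β) (h : L.length + 2 ≤ Fintype.card β) :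
    ∃ c c' : β, c ∉ L ∧ c' ∉ L ∧ c ≠ c' := by
  have h1 : L.toFinset.card < (Finset.univ : Finset β).card := by
    rw [Finset.card_univ]
    exact lt_of_le_of_lt (List.toFinset_card_le L) (by omega)
  obtain ⟨c, -, hc⟩ := Finset.exists_mem_notMem_of_card_lt_card h1
  have h2 : (insert c L.toFinset).card < (Finset.univ : Finset β).card := by
    rw [Finset.card_univ]
    refine lt_of_le_of_lt (Finset.card_insert_le _ _) ?_
    have := List.toFinset_card_le L
    omega
  obtain ⟨c', -, hc'⟩ := Finset.exists_mem_notMem_of_card_lt_card h2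
  rw [Finset.mem_insert, not_or] at hc'
  exact ⟨c, c', fun h => hc (List.mem_toFinset.2 h), fun h => hc'.2 (List.mem_toFinset.2 h),
    fun h => hc'.1 h.symm⟩

end LowerMoves

/-! ### Parity (Euler characteristic): `orb(σπ) ≡ |w|/2 + 1 (mod 2)` -/

section Parity

variable {β : Type*} [Fintype β] [DecidableEq β]

/-- The sign of a permutation is `(-1)^(|β| + number of orbits)` (computed in `ℤ`). [folklore] -/
theorem val_sign_eq_neg_one_pow (ρ : Perm β) :
    ((Perm.sign ρ : ℤˣ) : ℤ) = (-1 : ℤ) ^ (Fintype.card β + ncl ρ) := by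
  rw [sign_of_cycleType, sum_cycleType, Units.val_pow_eq_pow_val, Units.val_neg, Units.val_one]
  have h1 := card_cycleType_add_card_fixed_eq_ncl ρ
  have h2 : ρ.support.card + (Finset.univ.filter fun x => ρ x = x).card = Fintype.card β := by
    have : (Finset.univ.filter fun x => ρ x = x) = ρ.supportᶜ := by
      ext x
      simp [mem_support]
    rw [this, Finset.card_add_card_compl]
  have : Fintype.card β + ncl ρ = (ρ.support.card + Multiset.card ρ.cycleType) +
      2 * (Finset.univ.filter fun x => ρ x = x).card := by omega
  rw [this]
  conv_rhs => rw [pow_add, pow_mul, neg_one_sq, one_pow, mul_one]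

/-- A fixed-point-free involution of a finite type has `|β| / 2` orbits. [folklore] -/
theorem two_mul_ncl_of_invol {π : Perm β} (hinv : ∀ x, π (π x) = x) (hne : ∀ x, π x ≠ x) :
    2 * ncl π = Fintype.card β := by
  have hππ : π ^ 2 = 1 := by
    ext x
    simp [sq, hinv]
  have hpow : ∀ n : ℕ, ∀ x, (π ^ n) x = x ∨ (π ^ n) x = π x := by
    intro n x
    rw [← Nat.div_add_mod n 2, pow_add, pow_mul, hππ, one_pow, one_mul]
    rcases Nat.mod_two_eq_zero_or_one n with h | h <;> simp [h]
  have hcls : ∀ x, cls π x = {x, π x} := by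
    intro x
    ext y
    simp only [mem_cls, Finset.mem_insert, Finset.mem_singleton]
    constructor
    · intro h
      obtain ⟨n, rfl⟩ := h.exists_nat_pow_eq
      exact hpow n x
    · rintro (rfl | rfl)
      · exact SameCycle.refl _ _
      · exact sameCycle_apply_right.2 (SameCycle.refl _ _)
  have hfib : ∀ C ∈ Finset.univ.image (cls π),
      (Finset.univ.filter fun x => cls π x = C).card = 2 := by
    intro C hC
    obtain ⟨x₀, -, rfl⟩ := Finset.mem_image.1 hC
    have : (Finset.univ.filter fun x => cls π x = cls π x₀) = cls π x₀ := by
      ext x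
      simp only [Finset.mem_filter, Finset.mem_univ, true_and, mem_cls, cls_eq_cls_iff]
      exact sameCycle_comm
    rw [this, hcls, Finset.card_pair (hne x₀).symm]
  have h := Finset.card_eq_sum_card_fiberwise (s := (Finset.univ : Finset β))
    (t := Finset.univ.image (cls π)) (f := cls π) (fun x _ => Finset.mem_image_of_mem _ (by simp))
  rw [Finset.sum_congr rfl hfib, Finset.sum_const, smul_eq_mul, Finset.card_univ] at h
  unfold ncl
  omega

/-- `(-1)^n` in `ℤ` by parity. [folklore] -/
theorem neg_one_pow_eq_ite (n : ℕ) : (-1 : ℤ) ^ n = if n % 2 = 0 then 1 else -1 := by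
  induction n with
  | zero => simp
  | succ n ih =>
    rw [pow_succ, ih]
    rcases Nat.mod_two_eq_zero_or_one n with h | h
    · have : (n + 1) % 2 = 1 := by omega
      simp [h, this]
    · have : (n + 1) % 2 = 0 := by omega
      simp [h, this]

/-- Comparing parities through powers of `-1`. [folklore] -/
theorem mod_two_eq_of_neg_one_pow_eq {a b : ℕ} (h : (-1 : ℤ) ^ a = (-1) ^ b) :
    a % 2 = b % 2 := by
  rw [neg_one_pow_eq_ite, neg_one_pow_eq_ite] at h
  rcases Nat.mod_two_eq_zero_or_one a with ha | ha <;>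
    rcases Nat.mod_two_eq_zero_or_one b with hb | hb <;> simp [ha, hb] at h <;> omega

/-- **Euler characteristic parity**: for a pairing `π` of a nonempty word `w`, `|w|` is even and
`orb(σπ) ≡ |w|/2 + 1 (mod 2)` (the pairing surface has integral genus). [folklore] -/
theorem orbitCount_parity {α : Type*} (w : List (α × Bool)) (hw : w ≠ [])
    (π : Perm (Fin w.length)) (hπ : IsPairing w π) :
    w.length % 2 = 0 ∧ (orbitCount ((finRotate w.length).trans π) + w.length / 2) % 2 = 1 := by
  have h2 := two_mul_ncl_of_invol (π := π) hπ.1 hπ.2.1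
  rw [Fintype.card_fin] at h2
  have hn : 1 ≤ w.length := by
    rcases w with - | ⟨d, w⟩
    · exact absurd rfl hw
    · simp
  refine ⟨by omega, ?_⟩
  have hsign : ((Perm.sign ((finRotate w.length).trans π) : ℤˣ) : ℤ) =
      ((Perm.sign π : ℤˣ) : ℤ) * ((Perm.sign (finRotate w.length) : ℤˣ) : ℤ) := by
    rw [show (finRotate w.length).trans π = π * finRotate w.length from rfl, Perm.sign_mul,
      Units.val_mul]
  rw [val_sign_eq_neg_one_pow, val_sign_eq_neg_one_pow π, sign_finRotate,
    Units.val_pow_eq_pow_val, Units.val_neg, Units.val_one, ← pow_add, Fintype.card_fin,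
    ← orbitCount_eq_ncl] at hsign
  have := mod_two_eq_of_neg_one_pow_eq hsign
  omega

end Parity

/-! ### The lower bound: a pairing of genus `≤ cl(w)` -/

section Lower

variable {β : Type*} [Fintype β] [DecidableEq β] {G : Type*} [Group G]

omit [Fintype β] [DecidableEq β] in
/-- The axioms of a pattern do not mention the cyclic order: they persist under any permutation
of the underlying list (the word and the orbit count of course change). [folklore] -/
theorem IsPat.perm {L L' : List β} {π : Perm β} {ℓ : β → G} (h : IsPat L π ℓ) (hp : L.Perm L') :
    IsPat L' π ℓ :=
  ⟨hp.nodup_iff.1 h.nodup, h.invol, fun _ hx => h.apply_of_not_mem (fun h' => hx (hp.mem_iff.1 h')),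
    fun _ hx => h.apply_ne (hp.mem_iff.2 hx), fun _ hx => h.label (hp.mem_iff.2 hx)⟩

/-- **Skeleton**: the word `[u₁,v₁]⋯[u_k,v_k]` is the word of a pattern with `4k` positions
labelled `uᵢ, vᵢ, uᵢ⁻¹, vᵢ⁻¹`. [folklore] -/
theorem exists_skeleton (l : List (G × G)) (hcard : 4 * l.length ≤ Fintype.card β) :
    ∃ (L : List β) (π : Perm β) (ℓ : β → G), IsPat L π ℓ ∧ L.length = 4 * l.length ∧
      (L.map ℓ).prod = (l.map fun p => p.1 * p.2 * p.1⁻¹ * p.2⁻¹).prod ∧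
      (∀ x ∈ L, ∃ p ∈ l, ℓ x = p.1 ∨ ℓ x = p.2 ∨ ℓ x = p.1⁻¹ ∨ ℓ x = p.2⁻¹) ∧
      ∀ F : G → ℕ, (L.map fun x => F (ℓ x)).sum =
        (l.map fun p => F p.1 + F p.2 + F p.1⁻¹ + F p.2⁻¹).sum := by
  induction l with
  | nil =>
    refine ⟨[], 1, fun _ => 1, ⟨List.nodup_nil, fun _ => rfl, fun _ _ => rfl,
      fun x hx => absurd hx List.not_mem_nil, fun x hx => absurd hx List.not_mem_nil⟩,
      rfl, rfl, fun x hx => absurd hx List.not_mem_nil, fun _ => rfl⟩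
  | cons p l ih =>
    simp only [List.length_cons] at hcard
    obtain ⟨L, π, ℓ, hP, hlen, hword, hlab, hsum⟩ := ih (by omega)
    obtain ⟨a, b, ha, hb, hab⟩ := exists_two_not_mem L (by omega)
    obtain ⟨a', b', ha'', hb'', ha'b'⟩ := exists_two_not_mem (a :: b :: L) (by simp; omega)
    simp only [List.mem_cons, not_or] at ha'' hb''
    obtain ⟨haa', hba', ha'⟩ := ha''
    obtain ⟨hab', hbb', hb'⟩ := hb''
    obtain ⟨π', ℓ', hP', -, hℓ'L, la, lb, la', lb'⟩ := hP.exists_append_block ha hb ha' hb' hab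
      (Ne.symm haa') (Ne.symm hab') (Ne.symm hba') (Ne.symm hbb') ha'b' p.1 p.2
    have hperm : (L ++ [a, b, a', b']).Perm (a :: b :: a' :: b' :: L) := List.perm_append_comm
    refine ⟨a :: b :: a' :: b' :: L, π', ℓ', hP'.perm hperm, by simp [hlen]; omega, ?_, ?_, ?_⟩
    · simp only [List.map_cons, List.prod_cons, la, lb, la', lb', List.map_congr_left hℓ'L, hword]
      simp [mul_assoc]
    · intro x hx
      simp only [List.mem_cons] at hx
      rcases hx with rfl | rfl | rfl | rfl | hx
      · exact ⟨p, List.mem_cons_self, Or.inl la⟩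
      · exact ⟨p, List.mem_cons_self, Or.inr (Or.inl lb)⟩
      · exact ⟨p, List.mem_cons_self, Or.inr (Or.inr (Or.inl la'))⟩
      · exact ⟨p, List.mem_cons_self, Or.inr (Or.inr (Or.inr lb'))⟩
      · obtain ⟨p', hp', h⟩ := hlab x hx
        rw [hℓ'L x hx]
        exact ⟨p', List.mem_cons_of_mem _ hp', h⟩
    · intro F
      have : (L.map fun x => F (ℓ' x)) = L.map fun x => F (ℓ x) :=
        List.map_congr_left fun x hx => by rw [hℓ'L x hx]
      simp only [List.map_cons, List.sum_cons, la, lb, la', lb', this, hsum F]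
      omega

/-- **Phase II (letters)**: a pattern with non-trivial labels in a free group can be subdivided
into a pattern all of whose labels are single letters, with the same word and genus bound.
[folklore] -/
theorem exists_letter_pattern {α : Type*} [DecidableEq α] (d₀ : α × Bool) (k : ℕ) (m : ℕ) :
    ∀ (L : List β) (π : Perm β) (ℓ : β → FreeGroup α), IsPat L π ℓ → L ≠ [] →
      (∀ x ∈ L, ℓ x ≠ 1) → (L.map fun x => (ℓ x).toWord.length - 1).sum = m →
      L.length + m + 2 ≤ Fintype.card β →
      2 * Fintype.card β + 2 ≤ 4 * k + 2 * ncl (List.formPerm L * π) + L.length →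
      ∃ (L' : List β) (π' : Perm β) (c : β → α × Bool),
        IsPat L' π' (fun x => FreeGroup.mk [c x]) ∧ L' ≠ [] ∧
        2 * Fintype.card β + 2 ≤ 4 * k + 2 * ncl (List.formPerm L' * π') + L'.length ∧
        (L'.map fun x => FreeGroup.mk [c x]).prod = (L.map ℓ).prod := by
  induction m using Nat.strong_induction_on with
  | _ m ih =>
  intro L π ℓ hP hne hnt hm hroom hinv
  by_cases hall : ∀ x ∈ L, (ℓ x).toWord.length ≤ 1
  · -- all labels are letters already
    let c : β → α × Bool := fun x => ((ℓ x).toWord.head?).getD d₀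
    have hc : ∀ x ∈ L, ℓ x = FreeGroup.mk [c x] := by
      intro x hx
      have h1 := hall x hx
      have h2 : (ℓ x).toWord ≠ [] := fun h => hnt x hx (FreeGroup.toWord_eq_nil_iff.1 h)
      obtain ⟨d, t, hdt⟩ := List.exists_cons_of_ne_nil h2
      have ht : t = [] := by
        rw [hdt] at h1
        simp only [List.length_cons, add_le_iff_nonpos_left, nonpos_iff_eq_zero,
          List.length_eq_zero_iff] at h1
        exact h1
      have hcx : c x = d := by simp [c, hdt]
      rw [hcx, ← FreeGroup.mk_toWord (x := ℓ x), hdt, ht]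
    refine ⟨L, π, c, ?_, hne, hinv, ?_⟩
    · refine ⟨hP.nodup, hP.invol, hP.2.2.1, hP.2.2.2.1, fun x hx => ?_⟩
      dsimp only
      rw [← hc x hx, ← hc (π x) (hP.apply_mem hx)]
      exact hP.label hx
    · exact congrArg List.prod (List.map_congr_left fun x hx => (hc x hx).symm)
  · -- subdivide a long label
    simp only [not_forall, not_le, exists_prop] at hall
    obtain ⟨e, he, hlong⟩ := hall
    obtain ⟨ch, rest, hcr⟩ : ∃ ch rest, (ℓ e).toWord = ch :: rest :=
      List.exists_cons_of_ne_nil (by intro h; rw [h] at hlong; simp at hlong)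
    have hrest : rest ≠ [] := by
      intro h
      rw [hcr, h] at hlong
      simp at hlong
    have hrl : 1 ≤ rest.length := by
      rcases rest with - | ⟨r, rs⟩
      · exact absurd rfl hrest
      · simp
    have hred : FreeGroup.IsReduced (ch :: rest) := hcr ▸ FreeGroup.isReduced_toWord
    have hredr : FreeGroup.IsReduced rest := hred.infix (List.suffix_cons ch rest).isInfix
    set p : FreeGroup α := FreeGroup.mk [ch] with hp
    set q : FreeGroup α := FreeGroup.mk rest with hq
    have hpq : ℓ e = p * q := by
      rw [← FreeGroup.mk_toWord (x := ℓ e), hcr, hp, hq, FreeGroup.mul_mk]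
      rfl
    have hp_w : p.toWord = [ch] := by
      rw [hp, FreeGroup.toWord_mk, FreeGroup.IsReduced.singleton.reduce_eq]
    have hq_w : q.toWord = rest := by rw [hq, FreeGroup.toWord_mk, hredr.reduce_eq]
    have hpi_w : p⁻¹.toWord.length = 1 := by
      rw [FreeGroup.toWord_inv, FreeGroup.invRev_length, hp_w]
      rfl
    have hqi_w : q⁻¹.toWord.length = rest.length := by
      rw [FreeGroup.toWord_inv, FreeGroup.invRev_length, hq_w]
    have hp1 : p ≠ 1 := by
      intro h
      have := congrArg FreeGroup.toWord h
      rw [hp_w, FreeGroup.toWord_one] at this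
      exact List.cons_ne_nil _ _ this
    have hq1 : q ≠ 1 := by
      intro h
      have := congrArg FreeGroup.toWord h
      rw [hq_w, FreeGroup.toWord_one] at this
      exact hrest this
    have hēw : (ℓ (π e)).toWord.length = rest.length + 1 := by
      rw [hP.label he, FreeGroup.toWord_inv, FreeGroup.invRev_length, hcr]
      rfl
    -- fresh positions and subdivision
    obtain ⟨c, c', hc, hc', hcc'⟩ := exists_two_not_mem L (by omega)
    obtain ⟨L', π', ℓ', hP', hperm, hword, hncl, le, lc, lc', lē, lo⟩ :=
      hP.exists_subdivide he hc hc' hcc' p q hpq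
    -- the measure drops by two
    set L₀ := (L.erase e).erase (π e) with hL₀
    have hpermL : L.Perm (e :: π e :: L₀) := by
      have hē : π e ∈ L.erase e := (List.mem_erase_of_ne (hP.apply_ne he)).2 (hP.apply_mem he)
      exact (List.perm_cons_erase he).trans (List.Perm.cons e (List.perm_cons_erase hē))
    have hL₀mem : ∀ x ∈ L₀, x ∈ L ∧ x ≠ e ∧ x ≠ π e := fun x hx => (hP.mem_delete_iff).1 hx
    have hsumL : (L.map fun x => (ℓ x).toWord.length - 1).sum =
        rest.length + rest.length + (L₀.map fun x => (ℓ x).toWord.length - 1).sum := by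
      rw [(hpermL.map _).sum_eq]
      simp only [List.map_cons, List.sum_cons, hcr, hēw, List.length_cons]
      omega
    have hsumL' : (L.map fun x => (ℓ' x).toWord.length - 1).sum =
        (L₀.map fun x => (ℓ x).toWord.length - 1).sum := by
      rw [(hpermL.map _).sum_eq]
      have : (L₀.map fun x => (ℓ' x).toWord.length - 1) =
          L₀.map fun x => (ℓ x).toWord.length - 1 := by
        apply List.map_congr_left
        intro x hx
        obtain ⟨h1, h2, h3⟩ := hL₀mem x hx
        rw [lo x h1 h2 h3]
      simp only [List.map_cons, List.sum_cons, le, lē, hp_w, hpi_w, this, List.length_singleton]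
      omega
    have hsum' : (L'.map fun x => (ℓ' x).toWord.length - 1).sum + 2 = m := by
      rw [(hperm.map _).sum_eq]
      simp only [List.map_cons, List.sum_cons, lc, lc', hq_w, hqi_w, hsumL']
      rw [← hm, hsumL]
      omega
    have hlen' : L'.length = L.length + 2 := by rw [hperm.length_eq]; simp
    have hne' : L' ≠ [] := by
      intro h
      rw [h] at hlen'
      simp at hlen'
    have hnt' : ∀ x ∈ L', ℓ' x ≠ 1 := by
      intro x hx
      rw [hperm.mem_iff] at hx
      simp only [List.mem_cons] at hx
      rcases hx with rfl | rfl | hx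
      · rw [lc]; exact hq1
      · rw [lc']; exact inv_ne_one.2 hq1
      · by_cases h1 : x = e
        · rw [h1, le]; exact hp1
        by_cases h2 : x = π e
        · rw [h2, lē]; exact inv_ne_one.2 hp1
        rw [lo x hx h1 h2]
        exact hnt x hx
    obtain ⟨L'', π'', cc, hP'', hne'', hinv'', hword''⟩ :=
      ih _ (by omega) L' π' ℓ' hP' hne' hnt' rfl (by omega) (by omega)
    exact ⟨L'', π'', cc, hP'', hne'', hinv'', hword''.trans hword⟩

omit [Fintype β] [DecidableEq β] in
/-- Index-congruence for `getElem`. [folklore] -/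
theorem getElem_congr_idx (L : List β) {a b : ℕ} (ha : a < L.length) (hb : b < L.length)
    (h : a = b) : L[a] = L[b] := by
  subst h
  rfl

/-- **Phase III (reduction)**: following the free reductions of the letter word of a pattern down
to the reduced word `w`, re-pairing and deleting the cancelling pairs, keeps a pattern and the
genus bound. [folklore] -/
theorem exists_red_pattern {α : Type*} [DecidableEq α] (k : ℕ) {w : List (α × Bool)}
    (hw : w ≠ []) {M : List (α × Bool)} (hred : FreeGroup.Red M w) :
    ∀ (L : List β) (π : Perm β) (c : β → α × Bool), L.map c = M →
      IsPat L π (fun x => FreeGroup.mk [c x]) →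
      2 * Fintype.card β + 2 ≤ 4 * k + 2 * ncl (List.formPerm L * π) + L.length →
      ∃ (L' : List β) (π' : Perm β), IsPat L' π' (fun x => FreeGroup.mk [c x]) ∧
        L'.map c = w ∧
        2 * Fintype.card β + 2 ≤ 4 * k + 2 * ncl (List.formPerm L' * π') + L'.length := by
  have hred' : Relation.ReflTransGen FreeGroup.Red.Step M w := hred
  clear hred
  induction hred' using Relation.ReflTransGen.head_induction_on with
  | refl =>
    intro L π c hM hP hinv
    exact ⟨L, π, hP, hM, hinv⟩
  | head hstep hrest ih =>
    intro L π c hM hP hinv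
    obtain @⟨u₁, u₂, a, bb⟩ := hstep
    obtain ⟨l₁, l₂', rfl, hl₁, hl₂'⟩ := List.map_eq_append_iff.1 hM
    obtain ⟨x, l₃, rfl, hx, hl₃⟩ := List.map_eq_cons_iff.1 hl₂'
    obtain ⟨y, l₂, rfl, hy, hl₂⟩ := List.map_eq_cons_iff.1 hl₃
    have hxL : x ∈ l₁ ++ x :: y :: l₂ := by simp
    have hxy : (fun z => FreeGroup.mk [c z]) y = ((fun z => FreeGroup.mk [c z]) x)⁻¹ := by
      show FreeGroup.mk [c y] = (FreeGroup.mk [c x])⁻¹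
      rw [hx, hy, FreeGroup.inv_mk]
      rfl
    have hwlen : 1 ≤ w.length := by
      rcases w with - | ⟨d, w⟩
      · exact absurd rfl hw
      · simp
    have h3 : 3 ≤ (l₁ ++ x :: y :: l₂).length := by
      have h1 := FreeGroup.Red.length_le hrest
      simp only [List.length_append, List.length_cons] at h1 ⊢
      have e1 : u₁.length = l₁.length := by rw [← hl₁, List.length_map]
      have e2 : u₂.length = l₂.length := by rw [← hl₂, List.length_map]
      omega
    -- make `x`, `y` paired
    obtain ⟨π₁, hP₁, hπ₁x, hncl₁⟩ : ∃ π₁ : Perm β, IsPat (l₁ ++ x :: y :: l₂) π₁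
        (fun z => FreeGroup.mk [c z]) ∧ π₁ x = y ∧
        ncl (List.formPerm (l₁ ++ x :: y :: l₂) * π) ≤
          ncl (List.formPerm (l₁ ++ x :: y :: l₂) * π₁) := by
      by_cases hπx : π x = y
      · exact ⟨π, hP, hπx, le_rfl⟩
      · obtain ⟨hP₁, h1, h2⟩ := hP.repair rfl hxy hπx
        exact ⟨_, hP₁, h1, h2⟩
    -- delete them
    have hdel := hP₁.delete hxL
    have hLeq : l₁ ++ x :: y :: l₂ = l₁ ++ x :: π₁ x :: l₂ := by rw [hπ₁x]
    have heq : ((l₁ ++ x :: y :: l₂).erase x).erase (π₁ x) = l₁ ++ l₂ :=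
      hP₁.delete_consecutive_eq hLeq
    rw [heq] at hdel
    have hncl := hP₁.ncl_add_one_le_ncl_delete hxL h3
    rw [heq] at hncl
    have hlen : (l₁ ++ l₂).length + 2 = (l₁ ++ x :: y :: l₂).length := by
      simp only [List.length_append, List.length_cons]
      omega
    exact ih (l₁ ++ l₂) _ c (by rw [List.map_append, hl₁, hl₂]) hdel (by omega)

/-- **Transport to `Fin |w|`**: a letter pattern spelling `w` yields a pairing of `w` (in the sense
of `IsPairing`) with the corresponding orbit count. [folklore] -/
theorem exists_isPairing_of_isPat {α : Type*} [DecidableEq α] {L : List β} {π : Perm β}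
    {c : β → α × Bool} (hP : IsPat L π (fun x => FreeGroup.mk [c x])) (w : List (α × Bool))
    (hw : L.map c = w) :
    ∃ πw : Perm (Fin w.length), IsPairing w πw ∧
      ncl (List.formPerm L * π) + w.length =
        orbitCount ((finRotate w.length).trans πw) + Fintype.card β := by
  subst hw
  have hlen : (L.map c).length = L.length := List.length_map _
  -- index functions
  let e : Fin (L.map c).length → β := fun i => L[i.val]'(by rw [← hlen]; exact i.2)
  have he_mem : ∀ i, e i ∈ L := fun i => List.getElem_mem _
  have he_inj : Function.Injective e := by
    intro i j hij
    exact Fin.ext ((hP.nodup.getElem_inj_iff).1 hij)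
  let f : Fin (L.map c).length → Fin (L.map c).length := fun i =>
    ⟨L.idxOf (π (e i)), by
      rw [hlen]
      exact List.idxOf_lt_length_iff.2 (hP.apply_mem (he_mem i))⟩
  have hef : ∀ i, e (f i) = π (e i) := fun i => List.getElem_idxOf _
  have hff : ∀ i, f (f i) = i := fun i => he_inj (by rw [hef, hef, hP.invol])
  have hfinv : Function.Involutive f := hff
  refine ⟨hfinv.toPerm f, ⟨hff, ?_, ?_⟩, ?_⟩
  · intro i h
    have h' : e (f i) = e i := congrArg e h
    rw [hef] at h'
    exact hP.apply_ne (he_mem i) h'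
  · intro i
    have hget : ∀ j : Fin (L.map c).length, (L.map c).get j = c (e j) := fun j => by
      simp [e, List.getElem_map]
    rw [hget, hget]
    change c (e (f i)) = _
    rw [hef]
    have hl := hP.label (he_mem i)
    change FreeGroup.mk [c (π (e i))] = (FreeGroup.mk [c (e i)])⁻¹ at hl
    rw [FreeGroup.inv_mk] at hl
    have h2 := FreeGroup.reduce.sound hl
    rw [FreeGroup.IsReduced.singleton.reduce_eq] at h2
    change FreeGroup.reduce [c (π (e i))] = FreeGroup.reduce [((c (e i)).1, !(c (e i)).2)] at h2
    rw [FreeGroup.IsReduced.singleton.reduce_eq] at h2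
    exact List.singleton_inj.1 h2
  · have hinter : ∀ i, (List.formPerm L * π) (e i) =
        e ((finRotate (L.map c).length * hfinv.toPerm f) i) := by
      intro i
      rw [Perm.mul_apply, Perm.mul_apply]
      change List.formPerm L (π (e i)) = e (finRotate _ (f i))
      rw [← hef]
      change List.formPerm L (L[(f i).val]'_) = L[((finRotate (L.map c).length) (f i)).val]'_
      rw [List.formPerm_apply_getElem _ hP.nodup]
      apply getElem_congr_idx
      haveI : NeZero (L.map c).length := (f i).neZero
      rw [finRotate_apply, Fin.val_add, Fin.val_one', Nat.add_mod_mod]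
      exact congrArg _ hlen.symm
    have hfix : ∀ x, (∀ i, e i ≠ x) → (List.formPerm L * π) x = x := by
      intro x hx
      apply hP.rho_apply_of_not_mem
      intro hxL
      obtain ⟨i, hi, rfl⟩ := List.getElem_of_mem hxL
      exact hx ⟨i, by rw [hlen]; exact hi⟩ rfl
    have h := ncl_add_card_eq_of_intertwine he_inj hinter hfix
    rw [Fintype.card_fin] at h
    rw [orbitCount_eq_ncl]
    have hconj : ncl ((finRotate (L.map c).length).trans (hfinv.toPerm f)) =
        ncl (finRotate (L.map c).length * hfinv.toPerm f) := by
      rw [show (finRotate (L.map c).length).trans (hfinv.toPerm f) =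
        hfinv.toPerm f * finRotate (L.map c).length from rfl]
      have : hfinv.toPerm f * finRotate (L.map c).length = hfinv.toPerm f *
          (finRotate (L.map c).length * hfinv.toPerm f) * (hfinv.toPerm f)⁻¹ := by group
      rw [this, ncl_conj]
    rw [hconj]
    omega

/-- **Lower bound**: a non-empty reduced word `w` in the commutator subgroup has a pairing `π`
with `|w| + 2 ≤ 4 cl(w) + 2 orb(σπ)`, i.e. of genus `≤ cl(w)`. [folklore] -/
theorem exists_isPairing_le {α : Type*} [DecidableEq α] (w : List (α × Bool)) (hw : w ≠ [])
    (hred : FreeGroup.IsReduced w) (hmem : FreeGroup.mk w ∈ commutator (FreeGroup α)) :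
    ∃ π : Perm (Fin w.length), IsPairing w π ∧
      w.length + 2 ≤ 4 * commutatorLength (FreeGroup.mk w) +
        2 * orbitCount ((finRotate w.length).trans π) := by
  set k := commutatorLength (FreeGroup.mk w) with hk
  -- a shortest expression as a product of commutators
  set S : Set ℕ := {m : ℕ | ∃ l : List (FreeGroup α × FreeGroup α), l.length = m ∧
    (l.map fun p => p.1 * p.2 * p.1⁻¹ * p.2⁻¹).prod = FreeGroup.mk w} with hS
  have hSne : S.Nonempty := by
    obtain ⟨l, hl⟩ := (exists_list_prod_eq_iff_mem_commutator _).2 hmem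
    exact ⟨l.length, l, rfl, hl⟩
  have hkS : k ∈ S := Nat.sInf_mem hSne
  obtain ⟨l, hl, hprod⟩ := hkS
  have hmk1 : FreeGroup.mk w ≠ 1 := by
    intro h
    have := FreeGroup.reduce.sound h
    rw [hred.reduce_eq] at this
    exact hw (by simpa using this)
  -- all entries are non-trivial (minimality)
  have hnt : ∀ p ∈ l, p.1 ≠ 1 ∧ p.2 ≠ 1 := by
    intro p hp
    by_contra hcon
    have h1 : p.1 * p.2 * p.1⁻¹ * p.2⁻¹ = 1 := by
      rcases not_and_or.1 hcon with h | h
      · rw [not_not] at h; simp [h]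
      · rw [not_not] at h; simp [h]
    obtain ⟨l₁, l₂, rfl⟩ := List.append_of_mem hp
    have hmem' : (l₁ ++ l₂).length ∈ S := by
      refine ⟨l₁ ++ l₂, rfl, ?_⟩
      rw [← hprod, prod_map_split, h1, mul_one, List.map_append, List.prod_append]
    have hkle : k ≤ (l₁ ++ l₂).length := Nat.sInf_le hmem'
    simp only [List.length_append, List.length_cons] at hl hkle
    omega
  have hk1 : 1 ≤ k := by
    by_contra h0
    have hl0 : l = [] := List.length_eq_zero_iff.1 (by omega)
    rw [hl0] at hprod
    exact hmk1 (by simpa using hprod.symm)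
  -- ambient type
  set M := (l.map fun p => (p.1.toWord.length - 1) + (p.2.toWord.length - 1) +
    (p.1⁻¹.toWord.length - 1) + (p.2⁻¹.toWord.length - 1)).sum with hM
  set N := 4 * k + M + 2 with hN
  obtain ⟨L₀, π₀, ℓ₀, hP₀, hlen₀, hword₀, hlab₀, hsum₀⟩ :=
    exists_skeleton (β := Fin N) l (by rw [Fintype.card_fin, hl]; omega)
  have hne₀ : L₀ ≠ [] := by
    intro h
    rw [h, hl] at hlen₀
    simp at hlen₀
    omega
  have hnt₀ : ∀ x ∈ L₀, ℓ₀ x ≠ 1 := by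
    intro x hx
    obtain ⟨p, hp, h⟩ := hlab₀ x hx
    obtain ⟨h1, h2⟩ := hnt p hp
    rcases h with h | h | h | h
    · rw [h]; exact h1
    · rw [h]; exact h2
    · rw [h]; exact inv_ne_one.2 h1
    · rw [h]; exact inv_ne_one.2 h2
  have hm₀ : (L₀.map fun x => (ℓ₀ x).toWord.length - 1).sum = M := by
    rw [hsum₀ fun g => g.toWord.length - 1, hM]
  have hinv₀ : 2 * Fintype.card (Fin N) + 2 ≤
      4 * k + 2 * ncl (List.formPerm L₀ * π₀) + L₀.length := by
    have := hP₀.card_sub_length_lt_ncl hne₀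
    rw [Fintype.card_fin] at this ⊢
    omega
  obtain ⟨d₀, -⟩ : ∃ d₀ : α × Bool, d₀ ∈ w := List.exists_mem_of_ne_nil w hw
  obtain ⟨L₁, π₁, c, hP₁, hne₁, hinv₁, hword₁⟩ := exists_letter_pattern d₀ k M L₀ π₀ ℓ₀ hP₀
    hne₀ hnt₀ hm₀ (by rw [Fintype.card_fin]; omega) hinv₀
  -- the letter word reduces to `w`
  have hmk : FreeGroup.mk (L₁.map c) = FreeGroup.mk w := by
    have h1 : (L₁.map fun x => FreeGroup.mk [c x]) =
        (L₁.map c).map fun d => FreeGroup.mk [d] := by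
      rw [List.map_map]
      rfl
    rw [← prod_map_mk_singleton (L₁.map c), ← h1, hword₁, hword₀, hprod]
  have hredw : FreeGroup.Red (L₁.map c) w := by
    have h1 : FreeGroup.Red (L₁.map c) (FreeGroup.reduce (L₁.map c)) := FreeGroup.reduce.red
    rwa [FreeGroup.reduce.sound hmk, hred.reduce_eq] at h1
  obtain ⟨L₂, π₂, hP₂, hmap₂, hinv₂⟩ := exists_red_pattern k hw hredw L₁ π₁ c rfl hP₁ hinv₁
  obtain ⟨πw, hπw, hncl⟩ := exists_isPairing_of_isPat hP₂ w hmap₂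
  refine ⟨πw, hπw, ?_⟩
  rw [Fintype.card_fin] at hinv₂ hncl
  have : w.length = L₂.length := by rw [← hmap₂, List.length_map]
  omega

end Lower

end PairingGenus

/-- **Bardakov's formula holds** ([Heuer2020, Thm 2.4], `k = 1`; [Bardakov2000]; [Culler1981]):
`cl(w) = |w|/4 − o/2 + 1/2` for a non-empty cyclically reduced word `w` in the commutator
subgroup, `o` the maximal number of orbits of `σπ` over the pairings `π` of `w`.

The proof is the combinatorial core of Culler's pairing-genus theorem: (upper bound) the word of
a pattern of genus `g` is a product of `g` commutators, by contracting non-loop edges after a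
gauge and splitting off handles along interlinked pairs (`PairingGenus.isProdComm_of_isPat`);
(lower bound) a product of `cl(w)` commutators carries a pattern of genus `≤ cl(w)` which survives
subdivision into letters and free reduction down to `w` (`PairingGenus.exists_isPairing_le`);
integrality of the genus is the sign computation `PairingGenus.orbitCount_parity`.
[cite: Heuer2020, Thm 2.4 (k = 1)] -/
theorem BardakovFormula_holds : BardakovFormula := by
  intro α w hw hcyc hmem
  classical
  set S : Finset (Equiv.Perm (Fin w.length)) := Finset.univ.filter (IsPairing w) with hS
  set f : Equiv.Perm (Fin w.length) → ℕ := fun π => orbitCount ((finRotate w.length).trans π)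
    with hf
  set c : ℕ := commutatorLength (FreeGroup.mk w) with hc
  -- lower bound and a pairing
  obtain ⟨π₁, hπ₁, hle⟩ := PairingGenus.exists_isPairing_le w hw hcyc.isReduced hmem
  have hπ₁S : π₁ ∈ S := Finset.mem_filter.2 ⟨Finset.mem_univ _, hπ₁⟩
  have hSne : S.Nonempty := ⟨π₁, hπ₁S⟩
  obtain ⟨π₀, hπ₀S, hπ₀⟩ := Finset.exists_mem_eq_sup S hSne f
  have hP₀ : IsPairing w π₀ := (Finset.mem_filter.1 hπ₀S).2
  have h1 : f π₁ ≤ S.sup f := Finset.le_sup hπ₁S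
  -- upper bound at the maximising pairing, with `g = c - 1` excluded
  have hc1 : 1 ≤ c := by
    by_contra h0
    have hc0 : c = 0 := by omega
    -- `c = 0` means `mk w = 1`
    have hSne' : {m : ℕ | ∃ l : List (FreeGroup α × FreeGroup α), l.length = m ∧
        (l.map fun p => p.1 * p.2 * p.1⁻¹ * p.2⁻¹).prod = FreeGroup.mk w}.Nonempty := by
      obtain ⟨l, hl⟩ := (exists_list_prod_eq_iff_mem_commutator _).2 hmem
      exact ⟨l.length, l, rfl, hl⟩
    obtain ⟨l, hl, hprod⟩ := Nat.sInf_mem hSne'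
    have hl0 : l = [] := List.length_eq_zero_iff.1 (by rw [hl]; exact hc0)
    rw [hl0] at hprod
    have h2 := FreeGroup.reduce.sound hprod.symm
    rw [hcyc.isReduced.reduce_eq] at h2
    exact hw (by simpa using h2)
  have hup : ¬(w.length + 2 ≤ 4 * (c - 1) + 2 * f π₀) := by
    intro h
    have := PairingGenus.commutatorLength_le_of_isPairing w hw π₀ hP₀ (c - 1) h
    rw [← hc] at this
    omega
  have hpar := PairingGenus.orbitCount_parity w hw π₀ hP₀
  have hpar₁ := PairingGenus.orbitCount_parity w hw π₁ hπ₁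
  change f π₁ ≤ S.sup f at h1
  change w.length + 2 ≤ 4 * c + 2 * f π₁ at hle
  rw [← hπ₀] at hup
  have ho : S.sup f = orbitCount ((finRotate w.length).trans π₀) := hπ₀
  have hf₁ : f π₁ = orbitCount ((finRotate w.length).trans π₁) := rfl
  -- integer identity: `4 c + 2 o = |w| + 2`
  have hnat : 4 * c + 2 * S.sup f = w.length + 2 := by omega
  have hq : (4 * c + 2 * S.sup f : ℚ) = (w.length : ℚ) + 2 := by exact_mod_cast hnat
  change (c : ℚ) = (w.length : ℚ) / 4 - ((S.sup f : ℕ) : ℚ) / 2 + 1 / 2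
  linarith

end Literature.GroupTheory.CombinatorialGroupTheory
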